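import Literature.Computability.Cryptography.HardCoreFunctionsHidingProduct
import Literature.Computability.Cryptography.LiuPassLemma53Hiding
import Literature.Computability.Complexity.UnaryBricks
import Literature.Computability.Complexity.FPStringBricks
import HarnessLib

/-!
# HILL's hashed one-way function `f'(x, i, r) = ⟨f(x), h_r(x)↾(i + O(log n)), i, r⟩` is hiding over `𝒯` (Håstad–Impagliazzo–Levin–Luby 1999, eq. (3), Lemma 6.1.1)

J. Håstad, R. Impagliazzo, L. A. Levin, M. Luby, *A pseudorandom generator from any one-way function*,
SIAM J. Comput. 28(4) (1999) 1364–1396 (read in the authors' preprint, `lit` key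
`galaxy-pdf--8752169249696178760`), §6.1 "Finding determined hidden bits":

> Let `f : {0,1}ⁿ → {0,1}^{ℓₙ}` be a one-way function and let `h : {0,1}^{pₙ} × {0,1}ⁿ → {0,1}^{n+⌈log 2n⌉}`
> be a universal hash function. … define `f'(x, i, r) = ⟨f(x), h_r(x)_{{1,…,i+⌈log(2n)⌉}}, i, r⟩` (3). …
> Let `𝒯 = {⟨x,i⟩ | x ∈ {0,1}ⁿ, i ∈ {0, …, D̃_f(f(x))}}` … **Lemma 6.1.1** Let `W = ⟨X̃, Ĩ⟩ ∈_𝒰 𝒯`, `R`, `Y`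
> uniform, `β ∈_𝒰 {0,1}`, `f` one-way. Then `⟨f'(W,R), X̃ ⊙ Y, Y⟩` and `⟨f'(W,R), β, Y⟩` are
> computationally indistinguishable. PROOF: … from Proposition 4.1.2 [Goldreich–Levin] there is an oracle
> TM `M'` such that `M'^{(A)}` … invert[s] `f'(W, R)` … Consider the following oracle TM `N`: `N^A` on
> input `f(x)` chooses `i ∈_𝒰 {0, …, n−1}`, `α ∈_𝒰 {0,1}^{i+⌈log(2n)⌉}`, and `r ∈_𝒰 {0,1}^{pₙ}` and runs
> `M'^{(A)}` on input `⟨f(x), α, i, r⟩`. Since `Pr[⟨x,i⟩ ∈ 𝒯] ≥ 1/n` … `N^A(f(X))` produces an inverse with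
> probability at least `1/n` times the probability `M'^{(A)}(f'(W,R))` produces an inverse.

Here `D̃_f(z) = ⌊log₂ #pre_f(z)⌋` (HILL Def. 2.3.6). This file vendors `f'` in the tree's format of hiding
randomized functions (`IsHidingOver`, `GoldreichLevinHiding.lean`; the Goldreich–Levin step of Lemma 6.1.1
is the tree's `goldreichLevin_hiding_len_holds`) and proves the inversion part of Lemma 6.1.1 — the machine
`N` — in the sharper **hiding** form: recovering the very input `⟨x, i⟩` from `f'(x, i, r)` over `𝒯` is as
hard as inverting `f`.

* Levels. The hiding input is one string `w = x ‖ ι ∈ {0,1}^N` carrying `x ∈ {0,1}^{n(N)}` and the index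
  `i = ⟦ι⟧ ∈ [0, 2^{b(N)})` in binary on `b(N) = ⌊log₂ N⌋ + 1` bits (`n(N) = N − b(N)`; HILL's `i` ranges over
  `[0, n)`, ours over `[0, 2^b) ⊇ [0, N]`, which only lowers the density of `𝒯` by a factor `≤ 2`); the hash
  is the affine family `AffineStr.hashStr` to `hLen N = n(N) + eLen N` bits, `eLen N = 2 b(N) + 4 ≥ ⌈log₂ 2n⌉`,
  keyed by the first bits of `r ∈ {0,1}^{rlen N}`, `rlen N = (2N+6)(N+1)` (a polynomial); the prefix
  `h_r(x)↾(i + eLen N)` is written zero-padded to the fixed length `hLen N` (`HILL.maskTo`), so that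
  `HILL.g f (w ‖ r) = f(x) ‖ maskTo (h_r(x)) ‖ ι ‖ r` has the fixed length `HILL.Lg N` (`length_g`).
* `HILL.Dtil f x = ⌊log₂ #{x' ∈ {0,1}^{|x|} : f x' = f x}⌋`, `HILL.T f c N = {w : ⟦ι⟧ ≤ D̃_f(f x) + c}` (`c = 0`
  is HILL's `𝒯`; `c = 1` is the enlarged set of the last paragraph of HILL §6), nonempty at every level.
* `HILL.G2`: an `FP` program with `G2 ⟨1^N, w ‖ r⟩ = g f (w ‖ r)` (`G2_apply`, `G2_mem_FP`).
* **`HILL.isHidingOver_g`**: for a length-preserving one-way `f`, `g f` is `T f c`-hiding for every `c`. The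
  inverter `N = HILL.adv` runs `A` on `⟨1^N, y ‖ maskTo(α) ‖ ι ‖ r⟩` with uniform `ι, α, r` (the level `N`
  above `n = |x|` and `A`'s coin count are handed over through the coin budget, as in
  `OneWayFunctionsLengthPreserving.lean`) and outputs the first `n` bits of `A`'s answer. Analysis
  (`sum_recovered_le`): for fixed `y, ι, r` and coins of `A`, the inputs `x ∈ f⁻¹(y)` that `A` recovers have
  pairwise distinct hash prefixes, each of which makes `N` succeed, so their number is at most
  `2^{i + eLen N} · Pr_α[N inverts] ≤ 2^{c + eLen N} · #f⁻¹(y) · Pr_α[N inverts]` when `i ≤ D̃ + c` — a linear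
  loss, `Pr[N inverts f on U_n] ≥ hidingProb(N) / 2^{b(N) + c + eLen(N)}` (`hidingProb_le`). (HILL's printed
  route goes through one-wayness of `f'` and Lemma 4.5.1; for hiding the count is direct.)
* `IsHidingOver.of_subset` — hiding over `S'` implies hiding over any `S ⊆ S'` of comparable size (used with
  HILL's enlarged `𝒯` of prescribed density, `T f 0 ⊆ 𝒯̃ ⊆ T f 1`).

## References

* J. Håstad, R. Impagliazzo, L. A. Levin, M. Luby, SIAM J. Comput. 28 (1999): Def. 2.3.6 (`D̃_f`), §4.4
  (Def. 4.4.2, matrix hashing), §5.1 Construction 5.1.1 and Lemma 5.1.2 (1) (the inverter with a guessed hash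
  value), §6.1 eq. (1)–(3), the sets `𝒯`, `𝒯̄`, Lemma 6.1.1; §6.3, last paragraph (enlarging `𝒯`).
* O. Goldreich, *Foundations of Cryptography I*, CUP 2001, §3.5.2 (the same step for regular `f`).
-/

namespace Literature.Computability.Cryptography

open Filter Asymptotics _root_.Computability Complexity Finset Polynomial AffineStr

namespace HILL

/-! ### Parameters of level `N` -/

/-- `b(N) = ⌊log₂ N⌋ + 1`: the number of bits of the index `i` (so `N < 2^{b(N)} ≤ 2N + 2`). [cite: HastadImpagliazzoLevinLuby1999, §6.1 eq. (3) (the input i of f')] -/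
def bLen (N : ℕ) : ℕ := Nat.log 2 N + 1

/-- `n(N) = N − b(N)`: the length of the `f`-input `x` inside a hiding input of length `N`. [cite: HastadImpagliazzoLevinLuby1999, §6.1 eq. (1)] -/
def nLen (N : ℕ) : ℕ := N - bLen N

/-- `ibLen N = N − n(N)`: the length of the index block (`= b(N)` for `N ≥ 1`). [folklore] -/
def ibLen (N : ℕ) : ℕ := N - nLen N

/-- `eLen N = 2 b(N) + 4`: the number of extra hash bits (HILL's `⌈log(2n)⌉`, with room to spare). [cite: HastadImpagliazzoLevinLuby1999, §6.1 eq. (2)–(3)] -/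
def eLen (N : ℕ) : ℕ := 2 * bLen N + 4

/-- `hLen N = n(N) + eLen N`: the full hash length (HILL's `n + ⌈log(2n)⌉`). [cite: HastadImpagliazzoLevinLuby1999, §6.1 eq. (2)] -/
def hLen (N : ℕ) : ℕ := nLen N + eLen N

/-- `rlen N = (2N + 6)(N + 1)`: the length of the randomness `r` (the hash key; at least `hLen N · (n(N) + 1)`
bits are needed by the affine family). [cite: HastadImpagliazzoLevinLuby1999, Def. 4.4.2 (matrix construction, (n+1)·m key bits)] -/
def rlen (N : ℕ) : ℕ := (2 * N + 6) * (N + 1)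

/-- The key length as a polynomial, `R0 = (2X + 6)(X + 1)`. [folklore] -/
noncomputable def R0 : Polynomial ℕ := (C 2 * X + C 6) * (X + 1)

/-- `R0(N) = rlen N`. [folklore] -/
@[simp] theorem R0_eval (N : ℕ) : R0.eval N = rlen N := by simp [R0, rlen]

/-- `N < 2^{b(N)}`. [folklore] -/
theorem lt_two_pow_bLen (N : ℕ) : N < 2 ^ bLen N := Nat.lt_pow_succ_log_self (by norm_num) N

/-- `2^{b(N)} ≤ 2N + 2`. [folklore] -/
theorem two_pow_bLen_le (N : ℕ) : 2 ^ bLen N ≤ 2 * N + 2 := by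
  unfold bLen
  rcases Nat.eq_zero_or_pos N with rfl | hN
  · simp
  · rw [pow_succ]
    have := Nat.pow_log_le_self 2 hN.ne'
    omega

/-- `b(N) ≤ N` for `N ≥ 1`. [folklore] -/
theorem bLen_le {N : ℕ} (hN : 1 ≤ N) : bLen N ≤ N := by
  have hlog : Nat.log 2 N < N := Nat.log_lt_self 2 (by omega)
  unfold bLen; omega

/-- `2k ≤ 2^k`. [folklore] -/
private theorem two_mul_le_two_pow (k : ℕ) : 2 * k ≤ 2 ^ k := by
  induction k with
  | zero => simp
  | succ k ih =>
    rcases k with _ | k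
    · simp
    · rw [pow_succ]; omega

/-- `2 ⌊log₂ N⌋ ≤ N`. [folklore] -/
private theorem two_mul_log_le (N : ℕ) : 2 * Nat.log 2 N ≤ N := by
  rcases Nat.eq_zero_or_pos N with rfl | hN
  · simp
  · exact (two_mul_le_two_pow _).trans (Nat.pow_log_le_self 2 hN.ne')

/-- `b(N) ≤ N + 1`. [folklore] -/
theorem bLen_le_succ (N : ℕ) : bLen N ≤ N + 1 := by
  rcases Nat.eq_zero_or_pos N with rfl | hN
  · simp [bLen]
  · exact (bLen_le hN).trans (Nat.le_succ N)

/-- `n(N) + b(N) = N` for `N ≥ 1`. [folklore] -/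
theorem nLen_add_bLen {N : ℕ} (hN : 1 ≤ N) : nLen N + bLen N = N := by
  have := bLen_le hN; unfold nLen; omega

/-- `ibLen N = b(N)` for `N ≥ 1`. [folklore] -/
theorem ibLen_eq {N : ℕ} (hN : 1 ≤ N) : ibLen N = bLen N := by
  have := nLen_add_bLen hN; unfold ibLen; omega

/-- `n(N) + ibLen N = N`. [folklore] -/
theorem nLen_add_ibLen (N : ℕ) : nLen N + ibLen N = N := by
  unfold ibLen nLen; omega

/-- `n(N) ≤ N`. [folklore] -/
theorem nLen_le (N : ℕ) : nLen N ≤ N := Nat.sub_le _ _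

/-- `ibLen N ≤ b(N)`. [folklore] -/
theorem ibLen_le_bLen (N : ℕ) : ibLen N ≤ bLen N := by unfold ibLen nLen; omega

/-- `hLen N ≤ 2N + 6`. [folklore] -/
theorem hLen_le (N : ℕ) : hLen N ≤ 2 * N + 6 := by
  rcases Nat.eq_zero_or_pos N with rfl | hN
  · simp [hLen, eLen, nLen, bLen]
  · have := bLen_le hN
    unfold hLen eLen nLen; omega

/-- **The key is long enough**: `hLen N · (n(N) + 1) ≤ rlen N`. [folklore] -/
theorem hLen_mul_le_rlen (N : ℕ) : hLen N * (nLen N + 1) ≤ rlen N := by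
  unfold rlen
  exact Nat.mul_le_mul (hLen_le N) (Nat.succ_le_succ (nLen_le N))

/-- `N ≤ 2 n(N) + 2` (the level is linear in the length of `x`). [folklore] -/
theorem le_two_mul_nLen (N : ℕ) : N ≤ 2 * nLen N + 2 := by
  have h := two_mul_log_le N
  unfold nLen bLen; omega

/-- The seed length `N + rlen N` is strictly increasing in `N`. [folklore] -/
theorem strictMono_seedLen : StrictMono fun N => N + rlen N := by
  refine strictMono_nat_of_lt_succ fun N => ?_
  unfold rlen; nlinarith

/-! ### Parsing a hiding input `w = x ‖ ι` -/

/-- `xOf w = w ↾ n(|w|)`: the `f`-input inside `w`. [cite: HastadImpagliazzoLevinLuby1999, §6.1 eq. (3)] -/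
def xOf (w : List Bool) : List Bool := w.take (nLen w.length)

/-- `iBits w = w ⇂ n(|w|)`: the index block `ι`. [cite: HastadImpagliazzoLevinLuby1999, §6.1 eq. (3)] -/
def iBits (w : List Bool) : List Bool := w.drop (nLen w.length)

/-- `iOf w = ⟦ι⟧`: the index `i` (binary, least significant bit first). [cite: HastadImpagliazzoLevinLuby1999, §6.1 eq. (3)] -/
def iOf (w : List Bool) : ℕ := bitsToNat (iBits w)

/-- `|xOf w| = n(|w|)`. [folklore] -/
@[simp] theorem length_xOf (w : List Bool) : (xOf w).length = nLen w.length := by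
  rw [xOf, List.length_take, min_eq_left (nLen_le _)]

/-- `|iBits w| = ibLen |w|`. [folklore] -/
@[simp] theorem length_iBits (w : List Bool) : (iBits w).length = ibLen w.length := by
  rw [iBits, List.length_drop, ibLen]

/-- `xOf w ‖ iBits w = w`. [folklore] -/
theorem xOf_append_iBits (w : List Bool) : xOf w ++ iBits w = w := List.take_append_drop _ _

/-- `iOf w < 2^{b(|w|)}`. [folklore] -/
theorem iOf_lt (w : List Bool) : iOf w < 2 ^ bLen w.length :=
  (bitsToNat_lt _).trans_le (Nat.pow_le_pow_right (by norm_num) (by rw [length_iBits]; exact ibLen_le_bLen _))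

/-- Parsing `x ‖ ι` with `|x| = n(N)`, `|ι| = ibLen N`: the `x`-part. [folklore] -/
theorem xOf_append {N : ℕ} {x ib : List Bool} (hx : x.length = nLen N) (hib : ib.length = ibLen N) :
    xOf (x ++ ib) = x := by
  have hN : (x ++ ib).length = N := by rw [List.length_append, hx, hib, nLen_add_ibLen]
  rw [xOf, hN, List.take_left' hx]

/-- Parsing `x ‖ ι`: the index block. [folklore] -/
theorem iBits_append {N : ℕ} {x ib : List Bool} (hx : x.length = nLen N) (hib : ib.length = ibLen N) :
    iBits (x ++ ib) = ib := by
  have hN : (x ++ ib).length = N := by rw [List.length_append, hx, hib, nLen_add_ibLen]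
  rw [iBits, hN, List.drop_left' hx]

/-- **The level of a seed length**: `lvl ℓ` is the largest `N ≤ ℓ` with `N + rlen N ≤ ℓ`. [folklore] -/
def lvl (ℓ : ℕ) : ℕ := Nat.findGreatest (fun N => N + rlen N ≤ ℓ) ℓ

/-- `lvl (N + rlen N) = N`. [folklore] -/
theorem lvl_eq (N : ℕ) : lvl (N + rlen N) = N := by
  unfold lvl
  rw [Nat.findGreatest_eq_iff]
  refine ⟨Nat.le_add_right _ _, fun _ => le_rfl, fun m hNm _ hm => ?_⟩
  exact absurd (hm.trans_lt' (strictMono_seedLen hNm)) (lt_irrefl _)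

/-! ### Degeneracy, the sets `𝒯_c` -/

/-- **HILL's approximate degeneracy** `D̃_f(f x) = ⌊log₂ #pre_f(f x)⌋`, written as a function of `x`:
`#{x' ∈ {0,1}^{|x|} : f x' = f x}` is the number of siblings of `x`. [cite: HastadImpagliazzoLevinLuby1999, Def. 2.3.6] -/
noncomputable def Dtil (f : List Bool → List Bool) (x : List Bool) : ℕ :=
  Nat.log 2 ((allStr x.length).filter fun x' => f x' = f x).card

/-- `Dtil` depends on `x` only through `f x` (and `|x|`). [folklore] -/
theorem Dtil_congr {f : List Bool → List Bool} {x x' : List Bool} (hlen : x.length = x'.length) (hf : f x = f x') :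
    Dtil f x = Dtil f x' := by
  unfold Dtil; rw [hlen, hf]

/-- `2^{D̃(x)} ≤ #siblings(x)`. [folklore] -/
theorem two_pow_Dtil_le (f : List Bool → List Bool) (x : List Bool) :
    2 ^ Dtil f x ≤ ((allStr x.length).filter fun x' => f x' = f x).card := by
  unfold Dtil
  refine Nat.pow_log_le_self 2 ?_
  exact (Finset.card_pos.2 ⟨x, by simp⟩).ne'

/-- `D̃(x) ≤ |x|`. [folklore] -/
theorem Dtil_le (f : List Bool → List Bool) (x : List Bool) : Dtil f x ≤ x.length := by
  have h := two_pow_Dtil_le f x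
  have h2 : ((allStr x.length).filter fun x' => f x' = f x).card ≤ 2 ^ x.length :=
    (Finset.card_le_card (Finset.filter_subset _ _)).trans (card_allStr _).le
  exact (Nat.pow_le_pow_iff_right (by norm_num)).1 (h.trans h2)

/-- **The sets `𝒯_c`**: `T f c N = {w ∈ {0,1}^N : ⟦ι⟧ ≤ D̃_f(f x) + c}` (`c = 0`: HILL's `𝒯`; `c = 1`: the
enlarged set of §6.3, last paragraph). [cite: HastadImpagliazzoLevinLuby1999, §6.1 (the set 𝒯) and §6.3 (last paragraph)] -/
noncomputable def T (f : List Bool → List Bool) (c : ℕ) (N : ℕ) : Finset (List.Vector Bool N) :=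
  Finset.univ.filter fun w => iOf w.toList ≤ Dtil f (xOf w.toList) + c

/-- Membership in `𝒯_c`. [folklore] -/
@[simp] theorem mem_T {f : List Bool → List Bool} {c N : ℕ} {w : List.Vector Bool N} :
    w ∈ T f c N ↔ iOf w.toList ≤ Dtil f (xOf w.toList) + c := by
  simp [T]

/-- The all-zero input lies in `𝒯_c` (`i = 0`). [folklore] -/
theorem zero_mem_T (f : List Bool → List Bool) (c N : ℕ) : List.Vector.replicate N false ∈ T f c N := by
  rw [mem_T]
  have h0 : (List.Vector.replicate N false).toList = List.replicate N false := rfl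
  have : iOf (List.replicate N false) = 0 := by
    unfold iOf iBits; rw [List.drop_replicate, bitsToNat_replicate_false]
  rw [h0, this]; exact Nat.zero_le _

/-- `𝒯_c` is nonempty at every level. [folklore] -/
theorem T_nonempty (f : List Bool → List Bool) (c N : ℕ) : (T f c N).Nonempty := ⟨_, zero_mem_T f c N⟩

/-- `𝒯_c ⊆ 𝒯_{c'}` for `c ≤ c'`. [folklore] -/
theorem T_mono (f : List Bool → List Bool) {c c' : ℕ} (h : c ≤ c') (N : ℕ) : T f c N ⊆ T f c' N :=
  fun w hw => by rw [mem_T] at hw ⊢; omega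

/-! ### The function `f'` as a randomized function `g f (w ‖ r)` -/

/-- **The masked hash value**: the first `i + eLen N` bits of `h`, zero-padded to `hLen N` bits (HILL pads
"with a special blank symbol"). [cite: HastadImpagliazzoLevinLuby1999, §6.1 eq. (3) with §2.3 (padding convention)] -/
def maskTo (N i : ℕ) (h : List Bool) : List Bool :=
  h.take (i + eLen N) ++ List.replicate (hLen N - (i + eLen N)) false

/-- `|maskTo N i h| = hLen N` for `|h| = hLen N`. [folklore] -/
theorem length_maskTo {N i : ℕ} {h : List Bool} (hh : h.length = hLen N) : (maskTo N i h).length = hLen N := by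
  rw [maskTo, List.length_append, List.length_take, List.length_replicate, hh]; omega

/-- `maskTo` is idempotent. [folklore] -/
theorem maskTo_maskTo {N i : ℕ} {h : List Bool} (hh : h.length = hLen N) : maskTo N i (maskTo N i h) = maskTo N i h := by
  unfold maskTo
  rcases le_or_gt (i + eLen N) (hLen N) with hle | hlt
  · have ht : (h.take (i + eLen N)).length = i + eLen N := by rw [List.length_take, hh, min_eq_left hle]
    rw [List.take_append_of_le_length (by rw [ht]), List.take_of_length_le (by rw [ht])]
  · have : hLen N - (i + eLen N) = 0 := by omega
    rw [this, List.replicate_zero, List.append_nil, List.append_nil, List.take_take, min_self]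

/-- Two strings with the same first `i + eLen N` bits have the same mask. [folklore] -/
theorem maskTo_eq_of_take_eq {N i : ℕ} {h h' : List Bool} (h1 : h.take (i + eLen N) = h'.take (i + eLen N)) :
    maskTo N i h = maskTo N i h' := by
  unfold maskTo; rw [h1]

/-- The index read off the block `ι`, capped at `2N + 2` (the cap is inactive on genuine blocks,
`|ι| ≤ b(N)`, `icap_eq`; it makes the programs below total). [folklore] -/
def icap (N : ℕ) (ib : List Bool) : ℕ := min (bitsToNat ib) (2 * N + 2)

/-- On a block of at most `b(N)` bits the cap is inactive. [folklore] -/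
theorem icap_eq {N : ℕ} {ib : List Bool} (hib : ib.length ≤ bLen N) : icap N ib = bitsToNat ib := by
  have h1 : bitsToNat ib < 2 ^ bLen N := (bitsToNat_lt ib).trans_le (Nat.pow_le_pow_right (by norm_num) hib)
  have h2 := two_pow_bLen_le N
  unfold icap; omega

/-- **The body of a sample / query**: `y ‖ maskTo (α) ‖ ι ‖ r`. [cite: HastadImpagliazzoLevinLuby1999, §6.1 eq. (3)] -/
def body (N : ℕ) (y ib α ρ : List Bool) : List Bool := y ++ maskTo N (icap N ib) α ++ ib ++ ρ

/-- `|body| = |y| + hLen N + |ι| + |r|` for `|α| = hLen N`. [folklore] -/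
theorem length_body {N : ℕ} (y ib ρ : List Bool) {α : List Bool} (hα : α.length = hLen N) :
    (body N y ib α ρ).length = y.length + hLen N + ib.length + ρ.length := by
  rw [body, List.length_append, List.length_append, List.length_append, length_maskTo hα]

variable (f : List Bool → List Bool)

/-- **HILL's `f'` as a randomized function on `w ‖ r`** (`|w| = N`, `|r| = rlen N`):
`g f (w ‖ r) = f(x) ‖ maskTo_N^{⟦ι⟧}(h_r(x)) ‖ ι ‖ r` with `w = x ‖ ι`, `h_r = hashStr (n N) (hLen N) r`.
[cite: HastadImpagliazzoLevinLuby1999, §6.1 eq. (3)] -/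
noncomputable def g (v : List Bool) : List Bool :=
  body (lvl v.length) (f (xOf (v.take (lvl v.length)))) (iBits (v.take (lvl v.length)))
    (hashStr (nLen (lvl v.length)) (hLen (lvl v.length)) (v.drop (lvl v.length)) (xOf (v.take (lvl v.length))))
    (v.drop (lvl v.length))

/-- The output length `Lg N = n(N) + hLen N + ibLen N + rlen N`. [folklore] -/
def Lg (N : ℕ) : ℕ := nLen N + hLen N + ibLen N + rlen N

variable {f}

/-- **Value of `g` on a seed `w ‖ r`.** [folklore] -/
theorem g_append {N : ℕ} {w ρ : List Bool} (hw : w.length = N) (hρ : ρ.length = rlen N) :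
    g f (w ++ ρ) = body N (f (xOf w)) (iBits w) (hashStr (nLen N) (hLen N) ρ (xOf w)) ρ := by
  have hl : lvl (w ++ ρ).length = N := by rw [List.length_append, hw, hρ, lvl_eq]
  simp only [g, hl, List.take_left' hw, List.drop_left' hw]

/-- **Value of `g` on `x ‖ ι ‖ r`.** [folklore] -/
theorem g_eq {N : ℕ} {x ib ρ : List Bool} (hx : x.length = nLen N) (hib : ib.length = ibLen N) (hρ : ρ.length = rlen N) :
    g f (x ++ ib ++ ρ) = body N (f x) ib (hashStr (nLen N) (hLen N) ρ x) ρ := by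
  rw [g_append (by rw [List.length_append, hx, hib, nLen_add_ibLen]) hρ, xOf_append hx hib, iBits_append hx hib]

/-- **Output length** of `g` for a length-preserving `f`. [folklore] -/
theorem length_g (hlp : IsLengthPreserving f) {N : ℕ} {w ρ : List Bool} (hw : w.length = N) (hρ : ρ.length = rlen N) :
    (g f (w ++ ρ)).length = Lg N := by
  rw [g_append hw hρ, length_body _ _ _ (length_hashStr ..), hlp, length_xOf, hw, length_iBits, hw, hρ, Lg]

/-- `g f` has the fixed output length `Lg` on the seeds of any family `S`. [folklore] -/
theorem hasSeedLength (hlp : IsLengthPreserving f) (S : ∀ N : ℕ, Finset (List.Vector Bool N)) :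
    HasSeedLength (g f) S rlen Lg :=
  fun _ w _ _ hρ => length_g hlp w.toList_length hρ

/-- `Lg N ≤ (2X+6)(X+1) + 3X + 6` evaluated at `N`, a polynomial bound. [folklore] -/
theorem Lg_le (N : ℕ) : Lg N ≤ ((C 2 * X + C 6) * (X + 1) + C 3 * X + C 6 : Polynomial ℕ).eval N := by
  have h1 := hLen_le N
  have h2 := nLen_add_ibLen N
  simp only [Lg, eval_add, eval_mul, eval_C, eval_X, eval_one]
  unfold rlen; nlinarith

/-! ### The program `G2 ⟨1^N, w ‖ r⟩ = g f (w ‖ r)` -/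

section Program

open Complexity.Brick Complexity.Plumb Complexity.OracleCompose

variable (f)

/-- `u = 1^N`. [folklore] -/
noncomputable def uF : List Bool → List Bool := fstF
/-- `1^{b(N)}` (`logFn` then one more). [folklore] -/
noncomputable def bU : List Bool → List Bool := List.cons true ∘ logFn ∘ uF
/-- `1^{n(N)} = 1^N ⇂ b(N)`. [folklore] -/
noncomputable def nU : List Bool → List Bool := dropFn ∘ fanoutFn bU uF
/-- `1^{eLen N}`. [folklore] -/
noncomputable def eU : List Bool → List Bool := concatFn ∘ fanoutFn (concatFn ∘ fanoutFn bU bU) (fun _ => ones 4)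
/-- `1^{hLen N}`. [folklore] -/
noncomputable def hU : List Bool → List Bool := concatFn ∘ fanoutFn nU eU
/-- `w = v ↾ N`. [folklore] -/
noncomputable def wF : List Bool → List Bool := takeFn ∘ fanoutFn uF sndF
/-- `r = v ⇂ N`. [folklore] -/
noncomputable def rF : List Bool → List Bool := dropFn ∘ fanoutFn uF sndF
/-- `x = w ↾ n(N)`. [folklore] -/
noncomputable def xF : List Bool → List Bool := takeFn ∘ fanoutFn nU wF
/-- `ι = w ⇂ n(N)`. [folklore] -/
noncomputable def ibF : List Bool → List Bool := dropFn ∘ fanoutFn nU wF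
/-- `h_r(x)`. [folklore] -/
noncomputable def hashF : List Bool → List Bool := AffineProg.hashFn ∘ fanoutFn (fanoutFn nU hU) (fanoutFn rF xF)
/-- `1^{⟦ι⟧}` (ruler `1^N 1^N 1 1`, longer than `2^{b(N)} > ⟦ι⟧`). [folklore] -/
noncomputable def iU : List Bool → List Bool :=
  binToUnaryFn ∘ fanoutFn (concatFn ∘ fanoutFn (concatFn ∘ fanoutFn uF uF) (fun _ => ones 2)) ibF
/-- `1^{⟦ι⟧ + eLen N}`. [folklore] -/
noncomputable def tU : List Bool → List Bool := concatFn ∘ fanoutFn iU eU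
/-- The masked hash `h ↾ (i + eLen) ‖ 0^{hLen − (i + eLen)}`. [folklore] -/
noncomputable def maskF : List Bool → List Bool :=
  concatFn ∘ fanoutFn (takeFn ∘ fanoutFn tU hashF) (Kannan.zerosFn ∘ dropFn ∘ fanoutFn tU hU)
/-- **The program `G2`.** [folklore] -/
noncomputable def G2 : List Bool → List Bool :=
  concatFn ∘ fanoutFn (concatFn ∘ fanoutFn (concatFn ∘ fanoutFn (f ∘ xF) maskF) ibF) rF

variable {f}

/-- `|1ⁿ| = n`. [folklore] -/
private theorem length_unaryEncodeNat' (n : ℕ) : (unaryEncodeNat n).length = n := unary_decode_encode_nat n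

/-- `uF ⟨1^N, v⟩ = 1^N`. [folklore] -/
theorem uF_pair (N : ℕ) (v : List Bool) : uF (boolPair (unaryEncodeNat N) v) = unaryEncodeNat N := by rw [uF, fstF_boolPair]

/-- `bU ⟨1^N, v⟩ = 1^{b(N)}`. [folklore] -/
theorem bU_pair (N : ℕ) (v : List Bool) : bU (boolPair (unaryEncodeNat N) v) = ones (bLen N) := by
  rw [bU, Function.comp_apply, Function.comp_apply, uF_pair, logFn, length_unaryEncodeNat', bLen, ones, ones, List.replicate_succ]

/-- `nU ⟨1^N, v⟩ = 1^{n(N)}`. [folklore] -/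
theorem nU_pair (N : ℕ) (v : List Bool) : nU (boolPair (unaryEncodeNat N) v) = ones (nLen N) := by
  rw [nU, Function.comp_apply, fanoutFn_apply, bU_pair, uF_pair, dropFn_boolPair, Complexity.unaryEncodeNat_eq_replicate, ones,
    List.length_replicate, List.drop_replicate, ones, nLen]

/-- `eU ⟨1^N, v⟩ = 1^{eLen N}`. [folklore] -/
theorem eU_pair (N : ℕ) (v : List Bool) : eU (boolPair (unaryEncodeNat N) v) = ones (eLen N) := by
  rw [eU, Function.comp_apply, fanoutFn_apply, Function.comp_apply, fanoutFn_apply, bU_pair, concatFn_boolPair, concatFn_boolPair,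
    Com.ones_append, Com.ones_append, eLen, two_mul]

/-- `hU ⟨1^N, v⟩ = 1^{hLen N}`. [folklore] -/
theorem hU_pair (N : ℕ) (v : List Bool) : hU (boolPair (unaryEncodeNat N) v) = ones (hLen N) := by
  rw [hU, Function.comp_apply, fanoutFn_apply, nU_pair, eU_pair, concatFn_boolPair, Com.ones_append, hLen]

/-- **`G2` computes `g`**: `G2 ⟨1^N, w ‖ r⟩ = g f (w ‖ r)` for `|w| = N`, `|r| = rlen N`. [folklore] -/
theorem G2_apply {N : ℕ} {w ρ : List Bool} (hw : w.length = N) (hρ : ρ.length = rlen N) :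
    G2 f (boolPair (unaryEncodeNat N) (w ++ ρ)) = g f (w ++ ρ) := by
  set z := boolPair (unaryEncodeNat N) (w ++ ρ) with hz
  have hN := length_unaryEncodeNat' N
  have hu : uF z = unaryEncodeNat N := uF_pair N _
  have hn : nU z = ones (nLen N) := nU_pair N _
  have he : eU z = ones (eLen N) := eU_pair N _
  have hh : hU z = ones (hLen N) := hU_pair N _
  have hwF : wF z = w := by
    rw [wF, Function.comp_apply, fanoutFn_apply, hu, hz, sndF_boolPair, takeFn_boolPair, hN, List.take_left' hw]
  have hrF : rF z = ρ := by
    rw [rF, Function.comp_apply, fanoutFn_apply, hu, hz, sndF_boolPair, dropFn_boolPair, hN, List.drop_left' hw]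
  have hxF : xF z = xOf w := by
    rw [xF, Function.comp_apply, fanoutFn_apply, hn, hwF, takeFn_boolPair, xOf, hw]; simp [ones]
  have hib : ibF z = iBits w := by
    rw [ibF, Function.comp_apply, fanoutFn_apply, hn, hwF, dropFn_boolPair, iBits, hw]; simp [ones]
  have hhash : hashF z = hashStr (nLen N) (hLen N) ρ (xOf w) := by
    rw [hashF, Function.comp_apply, fanoutFn_apply, fanoutFn_apply, fanoutFn_apply, hn, hh, hrF, hxF, AffineProg.hashFn_boolPair]
  have hi : iU z = ones (icap N (iBits w)) := by
    rw [iU, Function.comp_apply, fanoutFn_apply, Function.comp_apply, fanoutFn_apply, Function.comp_apply, fanoutFn_apply, hu, hib,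
      concatFn_boolPair, concatFn_boolPair, binToUnaryFn_boolPair, icap]
    simp only [List.length_append, hN, ones, List.length_replicate, two_mul]
  have ht : tU z = ones (icap N (iBits w) + eLen N) := by
    rw [tU, Function.comp_apply, fanoutFn_apply, hi, he, concatFn_boolPair, Com.ones_append]
  have hmask : maskF z = maskTo N (icap N (iBits w)) (hashStr (nLen N) (hLen N) ρ (xOf w)) := by
    rw [maskF, Function.comp_apply, fanoutFn_apply, Function.comp_apply, fanoutFn_apply, ht, hhash, takeFn_boolPair,
      Function.comp_apply, Function.comp_apply, fanoutFn_apply, ht, hh, dropFn_boolPair, Kannan.zerosFn_apply, concatFn_boolPair,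
      maskTo]
    simp [ones]
  rw [G2, Function.comp_apply, fanoutFn_apply, Function.comp_apply, fanoutFn_apply, Function.comp_apply, fanoutFn_apply,
    Function.comp_apply, hxF, hmask, hib, hrF, concatFn_boolPair, concatFn_boolPair, concatFn_boolPair, g_append hw hρ, body]

/-- **`G2 ∈ FP`** for `f ∈ FP`. [Arora–Barak 2009, §1.3] [folklore] -/
theorem G2_mem_FP (hf : f ∈ FP) : G2 f ∈ FP := by
  have hu : uF ∈ FP := fstF_mem_FP
  have hb : bU ∈ FP := comp_mem_FP (cons_mem_FP true) (comp_mem_FP logFn_mem_FP hu)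
  have hn : nU ∈ FP := comp_mem_FP dropFn_mem_FP (fanoutFn_mem_FP hb hu)
  have he : eU ∈ FP := comp_mem_FP concatFn_mem_FP (fanoutFn_mem_FP (comp_mem_FP concatFn_mem_FP (fanoutFn_mem_FP hb hb)) (const_mem_FP _))
  have hh : hU ∈ FP := comp_mem_FP concatFn_mem_FP (fanoutFn_mem_FP hn he)
  have hw : wF ∈ FP := comp_mem_FP takeFn_mem_FP (fanoutFn_mem_FP hu sndF_mem_FP)
  have hr : rF ∈ FP := comp_mem_FP dropFn_mem_FP (fanoutFn_mem_FP hu sndF_mem_FP)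
  have hx : xF ∈ FP := comp_mem_FP takeFn_mem_FP (fanoutFn_mem_FP hn hw)
  have hib : ibF ∈ FP := comp_mem_FP dropFn_mem_FP (fanoutFn_mem_FP hn hw)
  have hhash : hashF ∈ FP := comp_mem_FP AffineProg.hashFn_mem_FP (fanoutFn_mem_FP (fanoutFn_mem_FP hn hh) (fanoutFn_mem_FP hr hx))
  have hi : iU ∈ FP := comp_mem_FP binToUnaryFn_mem_FP (fanoutFn_mem_FP (comp_mem_FP concatFn_mem_FP (fanoutFn_mem_FP
    (comp_mem_FP concatFn_mem_FP (fanoutFn_mem_FP hu hu)) (const_mem_FP _))) hib)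
  have ht : tU ∈ FP := comp_mem_FP concatFn_mem_FP (fanoutFn_mem_FP hi he)
  have hmask : maskF ∈ FP := comp_mem_FP concatFn_mem_FP (fanoutFn_mem_FP (comp_mem_FP takeFn_mem_FP (fanoutFn_mem_FP ht hhash))
    (comp_mem_FP Kannan.zerosFn_mem_FP (comp_mem_FP dropFn_mem_FP (fanoutFn_mem_FP ht hh))))
  exact comp_mem_FP concatFn_mem_FP (fanoutFn_mem_FP (comp_mem_FP concatFn_mem_FP (fanoutFn_mem_FP
    (comp_mem_FP concatFn_mem_FP (fanoutFn_mem_FP (comp_mem_FP hf hx) hmask)) hib)) hr)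

end Program

/-! ### The query and the inverter `N` (HILL's oracle machine `N^A`, hiding form) -/

/-- **The query** `⟨1^N, y ‖ maskTo(α) ‖ ι ‖ r⟩`; on `y = f x`, `α = h_r(x)` this is `⟨1^N, g f (x ‖ ι ‖ r)⟩`.
[cite: HastadImpagliazzoLevinLuby1999, Lemma 6.1.1 (proof: "runs M'^{(A)} on input ⟨f(x), α, i, r⟩")] -/
def qry (N : ℕ) (y ib α ρ : List Bool) : List Bool := boolPair (unaryEncodeNat N) (body N y ib α ρ)

/-- The hiding challenge of `x ‖ ι` with randomness `r` is the query with `α = h_r(x)`. [folklore] -/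
theorem challenge_eq {N : ℕ} {x ib ρ : List Bool} (hx : x.length = nLen N) (hib : ib.length = ibLen N) (hρ : ρ.length = rlen N) :
    boolPair (unaryEncodeNat N) (g f (x ++ ib ++ ρ)) = qry N (f x) ib (hashStr (nLen N) (hLen N) ρ x) ρ := by
  rw [g_eq hx hib hρ, qry]

section Adversary

open Complexity.Brick Complexity.Plumb Complexity.OracleCompose

variable (A : RandAlg (List Bool) (List Bool)) (Kb : Polynomial ℕ)

/-- **The run of `N`** on `inp = ⟨1ⁿ, y⟩` with coins `r`: with `d = |r| / Kb(n)` (the level offset, decoded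
from the coin budget), `N = n + d` and `rest = r ⇂ d·Kb(n)` split as `ι ‖ α ‖ r' ‖ r_A`
(`|ι| = d`, `|α| = hLen N`, `|r'| = rlen N`), run `A` on `⟨1^N, y ‖ maskTo(α) ‖ ι ‖ r'⟩` with coins `r_A` and
output the first `n` bits of its answer. [cite: HastadImpagliazzoLevinLuby1999, Lemma 6.1.1 (proof, the oracle TM N)] -/
def advRun (inp r : List Bool) : List Bool :=
  (A.run (qry ((boolUnpair inp).1.length + r.length / Kb.eval (boolUnpair inp).1.length) (boolUnpair inp).2
      ((r.drop (r.length / Kb.eval (boolUnpair inp).1.length * Kb.eval (boolUnpair inp).1.length)).take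
        (r.length / Kb.eval (boolUnpair inp).1.length))
      (((r.drop (r.length / Kb.eval (boolUnpair inp).1.length * Kb.eval (boolUnpair inp).1.length)).drop
        (r.length / Kb.eval (boolUnpair inp).1.length)).take
          (hLen ((boolUnpair inp).1.length + r.length / Kb.eval (boolUnpair inp).1.length)))
      ((((r.drop (r.length / Kb.eval (boolUnpair inp).1.length * Kb.eval (boolUnpair inp).1.length)).drop
        (r.length / Kb.eval (boolUnpair inp).1.length)).drop
          (hLen ((boolUnpair inp).1.length + r.length / Kb.eval (boolUnpair inp).1.length))).take
            (rlen ((boolUnpair inp).1.length + r.length / Kb.eval (boolUnpair inp).1.length))))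
    ((((r.drop (r.length / Kb.eval (boolUnpair inp).1.length * Kb.eval (boolUnpair inp).1.length)).drop
        (r.length / Kb.eval (boolUnpair inp).1.length)).drop
          (hLen ((boolUnpair inp).1.length + r.length / Kb.eval (boolUnpair inp).1.length))).drop
            (rlen ((boolUnpair inp).1.length + r.length / Kb.eval (boolUnpair inp).1.length)))).take
    (boolUnpair inp).1.length

/-- **The inverter `N`** with a prescribed coin budget `cl`. [cite: HastadImpagliazzoLevinLuby1999, Lemma 6.1.1 (proof, the oracle TM N)] -/
def adv (cl : ℕ → ℕ) : RandAlg (List Bool) (List Bool) where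
  run := advRun A Kb
  coinLen := cl

/-- `1ⁿ` (`u`). [folklore] -/
noncomputable def unF : List Bool → List Bool := fstF ∘ fstF
/-- `y`. [folklore] -/
noncomputable def yF : List Bool → List Bool := sndF ∘ fstF
/-- `1^{Kb n}`. [folklore] -/
noncomputable def KbU : List Bool → List Bool := polyFn Kb ∘ unF
/-- `1^{d}`, `d = |r| / Kb n`. [folklore] -/
noncomputable def ddU : List Bool → List Bool := fstF ∘ divModFn ∘ fanoutFn (KbU Kb) (onesFn ∘ sndF)
/-- `rest = r ⇂ d·Kb n`. [folklore] -/
noncomputable def restF : List Bool → List Bool := dropFn ∘ fanoutFn (HashBricks.umulFn ∘ fanoutFn (ddU Kb) (KbU Kb)) sndF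
/-- `1^N = 1ⁿ ‖ 1^d`. [folklore] -/
noncomputable def NU : List Bool → List Bool := concatFn ∘ fanoutFn (onesFn ∘ unF) (ddU Kb)
/-- `⟨1^N, rest⟩`, the argument shape of the level bricks `hU`, `eU`. [folklore] -/
noncomputable def lvP : List Bool → List Bool := fanoutFn (NU Kb) (restF Kb)
/-- `ι = rest ↾ d`. [folklore] -/
noncomputable def ibA : List Bool → List Bool := takeFn ∘ fanoutFn (ddU Kb) (restF Kb)
/-- `rest ⇂ d`. [folklore] -/
noncomputable def r1F : List Bool → List Bool := dropFn ∘ fanoutFn (ddU Kb) (restF Kb)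
/-- `α = (rest ⇂ d) ↾ hLen N`. [folklore] -/
noncomputable def αF : List Bool → List Bool := takeFn ∘ fanoutFn (hU ∘ lvP Kb) (r1F Kb)
/-- `rest ⇂ (d + hLen N)`. [folklore] -/
noncomputable def r2F : List Bool → List Bool := dropFn ∘ fanoutFn (hU ∘ lvP Kb) (r1F Kb)
/-- `1^{rlen N}`. [folklore] -/
noncomputable def RLU : List Bool → List Bool := polyFn R0 ∘ NU Kb
/-- `r' = (rest ⇂ (d + hLen N)) ↾ rlen N`. [folklore] -/
noncomputable def ρA : List Bool → List Bool := takeFn ∘ fanoutFn (RLU Kb) (r2F Kb)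
/-- `A`'s coins. [folklore] -/
noncomputable def rAF : List Bool → List Bool := dropFn ∘ fanoutFn (RLU Kb) (r2F Kb)
/-- `1^{icap N ι}`. [folklore] -/
noncomputable def iA : List Bool → List Bool :=
  binToUnaryFn ∘ fanoutFn (concatFn ∘ fanoutFn (concatFn ∘ fanoutFn (NU Kb) (NU Kb)) (fun _ => ones 2)) (ibA Kb)
/-- `1^{icap N ι + eLen N}`. [folklore] -/
noncomputable def tA : List Bool → List Bool := concatFn ∘ fanoutFn (iA Kb) (eU ∘ lvP Kb)
/-- `maskTo(α)`. [folklore] -/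
noncomputable def maskA : List Bool → List Bool :=
  concatFn ∘ fanoutFn (takeFn ∘ fanoutFn (tA Kb) (αF Kb)) (Kannan.zerosFn ∘ dropFn ∘ fanoutFn (tA Kb) (hU ∘ lvP Kb))
/-- The body of the query. [folklore] -/
noncomputable def bodyA : List Bool → List Bool :=
  concatFn ∘ fanoutFn (concatFn ∘ fanoutFn (concatFn ∘ fanoutFn yF (maskA Kb)) (ibA Kb)) (ρA Kb)
/-- The query. [folklore] -/
noncomputable def qA' : List Bool → List Bool := fanoutFn (NU Kb) (bodyA Kb)
/-- **The whole run function on `⟨inp, r⟩`.** [folklore] -/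
noncomputable def runF : List Bool → List Bool := takeFn ∘ fanoutFn unF (LenPres.bFn A ∘ fanoutFn (qA' Kb) (rAF Kb))

variable {A Kb}

/-- `onesFn w = 1^{|w|}`. [folklore] -/
private theorem onesFn_eq_ones (w : List Bool) : onesFn w = ones w.length := by
  simp [onesFn, Complexity.unaryEncodeNat_eq_replicate, ones]

/-- **The pipeline computes the run function.** [folklore] -/
theorem runF_boolPair (inp r : List Bool) : runF A Kb (boolPair inp r) = advRun A Kb inp r := by
  set u := (boolUnpair inp).1 with hu
  set y := (boolUnpair inp).2 with hy
  set n := u.length with hn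
  set dd := r.length / Kb.eval n with hdd
  set N := n + dd with hN
  set rest := r.drop (dd * Kb.eval n) with hrest_def
  have huF : unF (boolPair inp r) = u := by rw [unF, Function.comp_apply, fstF_boolPair]; rfl
  have hyF : yF (boolPair inp r) = y := by rw [yF, Function.comp_apply, fstF_boolPair]; rfl
  have hKb : KbU Kb (boolPair inp r) = ones (Kb.eval n) := by rw [KbU, Function.comp_apply, huF, polyFn_apply]
  have hddU : ddU Kb (boolPair inp r) = ones dd := by
    rw [ddU, Function.comp_apply, Function.comp_apply, fanoutFn_apply, hKb, Function.comp_apply, sndF_boolPair, onesFn_eq_ones,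
      divModFn_boolPair, fstF_boolPair]
  have hrest : restF Kb (boolPair inp r) = rest := by
    rw [restF, Function.comp_apply, fanoutFn_apply, Function.comp_apply, fanoutFn_apply, hddU, hKb, HashBricks.umulFn_apply,
      fstF_boolPair, sndF_boolPair, List.length_replicate, List.length_replicate, sndF_boolPair, dropFn_boolPair, List.length_replicate]
  have hNU : NU Kb (boolPair inp r) = unaryEncodeNat N := by
    rw [NU, Function.comp_apply, fanoutFn_apply, Function.comp_apply, huF, onesFn_eq_ones, hddU, concatFn_boolPair, Com.ones_append,
      Complexity.unaryEncodeNat_eq_replicate, ones]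
  have hlv : lvP Kb (boolPair inp r) = boolPair (unaryEncodeNat N) rest := by rw [lvP, fanoutFn_apply, hNU, hrest]
  have hib : ibA Kb (boolPair inp r) = rest.take dd := by
    rw [ibA, Function.comp_apply, fanoutFn_apply, hddU, hrest, takeFn_boolPair, List.length_replicate]
  have hr1 : r1F Kb (boolPair inp r) = rest.drop dd := by
    rw [r1F, Function.comp_apply, fanoutFn_apply, hddU, hrest, dropFn_boolPair, List.length_replicate]
  have hhU : (hU ∘ lvP Kb) (boolPair inp r) = ones (hLen N) := by rw [Function.comp_apply, hlv, hU_pair]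
  have heU : (eU ∘ lvP Kb) (boolPair inp r) = ones (eLen N) := by rw [Function.comp_apply, hlv, eU_pair]
  have hα : αF Kb (boolPair inp r) = (rest.drop dd).take (hLen N) := by
    rw [αF, Function.comp_apply, fanoutFn_apply, hhU, hr1, takeFn_boolPair, List.length_replicate]
  have hr2 : r2F Kb (boolPair inp r) = (rest.drop dd).drop (hLen N) := by
    rw [r2F, Function.comp_apply, fanoutFn_apply, hhU, hr1, dropFn_boolPair, List.length_replicate]
  have hRL : RLU Kb (boolPair inp r) = ones (rlen N) := by
    rw [RLU, Function.comp_apply, hNU, polyFn_apply, length_unaryEncodeNat', R0_eval]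
  have hρ : ρA Kb (boolPair inp r) = ((rest.drop dd).drop (hLen N)).take (rlen N) := by
    rw [ρA, Function.comp_apply, fanoutFn_apply, hRL, hr2, takeFn_boolPair, List.length_replicate]
  have hrA : rAF Kb (boolPair inp r) = ((rest.drop dd).drop (hLen N)).drop (rlen N) := by
    rw [rAF, Function.comp_apply, fanoutFn_apply, hRL, hr2, dropFn_boolPair, List.length_replicate]
  have hi : iA Kb (boolPair inp r) = ones (icap N (rest.take dd)) := by
    rw [iA, Function.comp_apply, fanoutFn_apply, Function.comp_apply, fanoutFn_apply, Function.comp_apply, fanoutFn_apply, hNU, hib,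
      concatFn_boolPair, concatFn_boolPair, binToUnaryFn_boolPair, icap]
    simp only [List.length_append, length_unaryEncodeNat', ones, List.length_replicate, two_mul]
  have ht : tA Kb (boolPair inp r) = ones (icap N (rest.take dd) + eLen N) := by
    rw [tA, Function.comp_apply, fanoutFn_apply, hi, heU, concatFn_boolPair, Com.ones_append]
  have hmask : maskA Kb (boolPair inp r) = maskTo N (icap N (rest.take dd)) ((rest.drop dd).take (hLen N)) := by
    rw [maskA, Function.comp_apply, fanoutFn_apply, Function.comp_apply, fanoutFn_apply, ht, hα, takeFn_boolPair,
      Function.comp_apply, Function.comp_apply, fanoutFn_apply, ht, hhU, dropFn_boolPair, Kannan.zerosFn_apply, concatFn_boolPair,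
      maskTo]
    simp [ones]
  have hbody : bodyA Kb (boolPair inp r) = body N y (rest.take dd) ((rest.drop dd).take (hLen N))
      (((rest.drop dd).drop (hLen N)).take (rlen N)) := by
    rw [bodyA, Function.comp_apply, fanoutFn_apply, Function.comp_apply, fanoutFn_apply, Function.comp_apply, fanoutFn_apply, hyF,
      hmask, hib, hρ, concatFn_boolPair, concatFn_boolPair, concatFn_boolPair, body]
  have hq : qA' Kb (boolPair inp r) = qry N y (rest.take dd) ((rest.drop dd).take (hLen N)) (((rest.drop dd).drop (hLen N)).take (rlen N)) := by
    rw [qA', fanoutFn_apply, hNU, hbody, qry]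
  rw [runF, Function.comp_apply, fanoutFn_apply, huF, Function.comp_apply, fanoutFn_apply, hq, hrA, LenPres.bFn, Function.comp_apply,
    boolUnpair_boolPair, takeFn_boolPair]
  rfl

/-- `runF ∈ FP` for a PPT `A`. [Arora–Barak 2009, §1.3] [folklore] -/
theorem runF_mem_FP (hA : IsPPT A id) : runF A Kb ∈ FP := by
  have hb : LenPres.bFn A ∈ FP := by
    show PolyTimeComputable id id (Function.uncurry A.run ∘ boolUnpair)
    exact PolyTimeComputable.comp_holds hA.1 polyTimeComputable_boolUnpair
  have hu : unF ∈ FP := comp_mem_FP fstF_mem_FP fstF_mem_FP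
  have hy : yF ∈ FP := comp_mem_FP sndF_mem_FP fstF_mem_FP
  have hKb : KbU Kb ∈ FP := comp_mem_FP (polyFn_mem_FP _) hu
  have hdd : ddU Kb ∈ FP := comp_mem_FP fstF_mem_FP (comp_mem_FP divModFn_mem_FP (fanoutFn_mem_FP hKb (comp_mem_FP onesFn_mem_FP sndF_mem_FP)))
  have hrest : restF Kb ∈ FP := comp_mem_FP dropFn_mem_FP (fanoutFn_mem_FP (comp_mem_FP HashBricks.umulFn_mem_FP (fanoutFn_mem_FP hdd hKb)) sndF_mem_FP)
  have hN : NU Kb ∈ FP := comp_mem_FP concatFn_mem_FP (fanoutFn_mem_FP (comp_mem_FP onesFn_mem_FP hu) hdd)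
  have hlv : lvP Kb ∈ FP := fanoutFn_mem_FP hN hrest
  have hbU : bU ∈ FP := comp_mem_FP (cons_mem_FP true) (comp_mem_FP logFn_mem_FP fstF_mem_FP)
  have hnU : nU ∈ FP := comp_mem_FP dropFn_mem_FP (fanoutFn_mem_FP hbU fstF_mem_FP)
  have heU : eU ∈ FP := comp_mem_FP concatFn_mem_FP (fanoutFn_mem_FP (comp_mem_FP concatFn_mem_FP (fanoutFn_mem_FP hbU hbU)) (const_mem_FP _))
  have hhU : hU ∈ FP := comp_mem_FP concatFn_mem_FP (fanoutFn_mem_FP hnU heU)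
  have hib : ibA Kb ∈ FP := comp_mem_FP takeFn_mem_FP (fanoutFn_mem_FP hdd hrest)
  have hr1 : r1F Kb ∈ FP := comp_mem_FP dropFn_mem_FP (fanoutFn_mem_FP hdd hrest)
  have hα : αF Kb ∈ FP := comp_mem_FP takeFn_mem_FP (fanoutFn_mem_FP (comp_mem_FP hhU hlv) hr1)
  have hr2 : r2F Kb ∈ FP := comp_mem_FP dropFn_mem_FP (fanoutFn_mem_FP (comp_mem_FP hhU hlv) hr1)
  have hRL : RLU Kb ∈ FP := comp_mem_FP (polyFn_mem_FP _) hN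
  have hρ : ρA Kb ∈ FP := comp_mem_FP takeFn_mem_FP (fanoutFn_mem_FP hRL hr2)
  have hrA : rAF Kb ∈ FP := comp_mem_FP dropFn_mem_FP (fanoutFn_mem_FP hRL hr2)
  have hi : iA Kb ∈ FP := comp_mem_FP binToUnaryFn_mem_FP (fanoutFn_mem_FP (comp_mem_FP concatFn_mem_FP (fanoutFn_mem_FP
    (comp_mem_FP concatFn_mem_FP (fanoutFn_mem_FP hN hN)) (const_mem_FP _))) hib)
  have ht : tA Kb ∈ FP := comp_mem_FP concatFn_mem_FP (fanoutFn_mem_FP hi (comp_mem_FP heU hlv))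
  have hmask : maskA Kb ∈ FP := comp_mem_FP concatFn_mem_FP (fanoutFn_mem_FP (comp_mem_FP takeFn_mem_FP (fanoutFn_mem_FP ht hα))
    (comp_mem_FP Kannan.zerosFn_mem_FP (comp_mem_FP dropFn_mem_FP (fanoutFn_mem_FP ht (comp_mem_FP hhU hlv)))))
  have hbody : bodyA Kb ∈ FP := comp_mem_FP concatFn_mem_FP (fanoutFn_mem_FP (comp_mem_FP concatFn_mem_FP (fanoutFn_mem_FP
    (comp_mem_FP concatFn_mem_FP (fanoutFn_mem_FP hy hmask)) hib)) hρ)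
  have hq : qA' Kb ∈ FP := fanoutFn_mem_FP hN hbody
  exact comp_mem_FP takeFn_mem_FP (fanoutFn_mem_FP hu (comp_mem_FP hb (fanoutFn_mem_FP hq hrA)))

/-- The run function of `N` is polynomial-time on the pair presentation. [Goldreich 2001, §1.3.2] [folklore] -/
theorem advRun_polyTime (hA : IsPPT A id) :
    PolyTimeComputable (fun q : List Bool × List Bool => boolPair (id q.1) q.2) id (Function.uncurry (advRun A Kb)) := by
  obtain ⟨pc, Mc, hM⟩ := runF_mem_FP (A := A) (Kb := Kb) hA
  refine ⟨pc, Mc, fun q => ?_⟩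
  have h := hM (boolPair q.1 q.2)
  rw [id, runF_boolPair] at h
  exact h

/-- **`N` is PPT** for a PPT `A` and a polynomially bounded budget. [folklore] -/
theorem adv_isPPT (hA : IsPPT A id) {cl : ℕ → ℕ} (hcl : ∃ pc : Polynomial ℕ, ∀ ℓ, cl ℓ ≤ pc.eval ℓ) : IsPPT (adv A Kb cl) id :=
  ⟨advRun_polyTime hA, hcl⟩

end Adversary

/-! ### The coin budget: the level `N` above `n` and `A`'s coin count -/

section Budget

variable (A : RandAlg (List Bool) (List Bool)) (qA : Polynomial ℕ) (Nst : ℕ → ℕ)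

/-- `κ(N)`: `A`'s coin count on the hiding challenges `⟨1^N, g f (w ‖ r)⟩` of level `N`. [folklore] -/
def κA (N : ℕ) : ℕ := A.coinLen (2 * N + 2 + Lg N)

/-- A polynomial bound on `Lg`. [folklore] -/
noncomputable def LgP : Polynomial ℕ := (C 2 * X + C 6) * (X + 1) + C 3 * X + C 6

/-- **The block size of the coin code** (exceeds `d + hLen N + rlen N + κ N` for every level `N ≤ 2n + 2`). [folklore] -/
noncomputable def Kb : Polynomial ℕ :=
  X + C 3 + (C 4 * X + C 10) + R0.comp (C 2 * X + C 2) + qA.comp (C 4 * X + C 6 + LgP.comp (C 2 * X + C 2)) + C 1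

/-- **The coin code** `Code n = d·Kb(n) + (d + hLen N + rlen N + κ N)` for the chosen level `N = Nst n`, `d = N − n`. [folklore] -/
noncomputable def Code (n : ℕ) : ℕ :=
  (Nst n - n) * (Kb qA).eval n + ((Nst n - n) + (hLen (Nst n) + (rlen (Nst n) + κA A (Nst n))))

/-- **The budget of `N`**: the challenges `⟨1ⁿ, f x⟩` (`|x| = n`, `f` length-preserving) have length `3n + 2`. [folklore] -/
noncomputable def cl (ℓ : ℕ) : ℕ := if ℓ % 3 = 2 then Code A qA Nst ((ℓ - 2) / 3) else 0

variable {A qA Nst}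

/-- `Lg N ≤ LgP(N)`. [folklore] -/
theorem Lg_le_LgP (N : ℕ) : Lg N ≤ LgP.eval N := Lg_le N

/-- **The block is large enough**: `d + hLen N + rlen N + κ N < Kb n` for `n ≤ N ≤ 2n + 2`. [folklore] -/
theorem lt_Kb (hqA : ∀ ℓ, A.coinLen ℓ ≤ qA.eval ℓ) {n N : ℕ} (h1 : n ≤ N) (h2 : N ≤ 2 * n + 2) :
    (N - n) + (hLen N + (rlen N + κA A N)) < (Kb qA).eval n := by
  have hh := hLen_le N
  have hr : rlen N ≤ (R0.comp (C 2 * X + C 2)).eval n := by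
    have : rlen N ≤ rlen (2 * n + 2) := by unfold rlen; nlinarith
    simpa only [eval_comp, eval_add, eval_mul, eval_C, eval_X, R0_eval] using this
  have hκ : κA A N ≤ (qA.comp (C 4 * X + C 6 + LgP.comp (C 2 * X + C 2))).eval n := by
    unfold κA
    refine (hqA _).trans ?_
    simp only [eval_comp, eval_add, eval_mul, eval_C, eval_X]
    refine TM2Iter.eval_mono _ ?_
    have := (Lg_le_LgP N).trans (TM2Iter.eval_mono LgP h2)
    omega
  have hK : (Kb qA).eval n = n + 3 + (4 * n + 10) + (R0.comp (C 2 * X + C 2)).eval n +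
      (qA.comp (C 4 * X + C 6 + LgP.comp (C 2 * X + C 2))).eval n + 1 := by
    simp only [Kb, eval_add, eval_X, eval_C, eval_mul]
  rw [hK]
  omega

/-- Decoding: `Code n / Kb n = Nst n − n`. [folklore] -/
theorem Code_div (hqA : ∀ ℓ, A.coinLen ℓ ≤ qA.eval ℓ) {n : ℕ} (h1 : n ≤ Nst n) (h2 : Nst n ≤ 2 * n + 2) :
    Code A qA Nst n / (Kb qA).eval n = Nst n - n := by
  have hK := lt_Kb (A := A) hqA h1 h2
  rw [Code, Nat.add_comm, Nat.add_mul_div_right _ _ (by omega), Nat.div_eq_of_lt hK, Nat.zero_add]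

/-- `Code n ≤ ((X + 3)·Kb)(n)`. [folklore] -/
theorem Code_le (hqA : ∀ ℓ, A.coinLen ℓ ≤ qA.eval ℓ) {n : ℕ} (h1 : n ≤ Nst n) (h2 : Nst n ≤ 2 * n + 2) :
    Code A qA Nst n ≤ ((X + C 3) * Kb qA).eval n := by
  have hK := lt_Kb (A := A) hqA h1 h2
  rw [eval_mul, eval_add, eval_X, eval_C, Code]
  have hd : Nst n - n ≤ n + 2 := by omega
  nlinarith

/-- The budget is polynomially bounded (for level choices `n ≤ Nst n ≤ 2n + 2`). [folklore] -/
theorem cl_le (hqA : ∀ ℓ, A.coinLen ℓ ≤ qA.eval ℓ) (hN : ∀ n, n ≤ Nst n ∧ Nst n ≤ 2 * n + 2) (ℓ : ℕ) :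
    cl A qA Nst ℓ ≤ ((X + C 3) * Kb qA).eval ℓ := by
  unfold cl
  split_ifs with h
  · exact (Code_le hqA (hN _).1 (hN _).2).trans (TM2Iter.eval_mono _ (by omega))
  · exact Nat.zero_le _

/-- **On the challenges `⟨1ⁿ, f x⟩`, `|x| = n`, the budget is `Code n`** (`f` length-preserving). [folklore] -/
theorem cl_eq (hlp : IsLengthPreserving f) {n : ℕ} {x : List Bool} (hx : x.length = n) :
    cl A qA Nst (boolPair (unaryEncodeNat n) (f x)).length = Code A qA Nst n := by
  have hℓ : (boolPair (unaryEncodeNat n) (f x)).length = 3 * n + 2 := by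
    rw [length_boolPair, length_unaryEncodeNat', hlp, hx]; ring
  unfold cl
  rw [hℓ, if_pos (by omega)]
  congr 1; omega

end Budget

/-! ### Counting: the success of `N` versus the recovering probability of `A` -/

section Counting

variable (f) (A : RandAlg (List Bool) (List Bool))

/-- The indicator that `N` inverts: `[f((A(qry; r_A)) ↾ n) = y]`. [folklore] -/
noncomputable def ind (N n : ℕ) (y ib α ρ rA : List Bool) : ℝ :=
  if f ((A.run (qry N y ib α ρ) rA).take n) = y then 1 else 0

/-- `P N n y ι`: the success of `N` on `⟨1ⁿ, y⟩` given the level `N` and the index block `ι`, averaged over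
`α`, `r` and `A`'s coins. [folklore] -/
noncomputable def P (N n : ℕ) (y ib : List Bool) : ℝ :=
  uniformAvg (hLen N) fun α => uniformAvg (rlen N) fun ρ => uniformAvg (κA A N) fun rA => ind f A N n y ib α ρ rA

/-- The indicator that `A` recovers `w` from the challenge `⟨1^N, g f (w ‖ r)⟩` with coins `r_A`. [folklore] -/
noncomputable def recInd (N : ℕ) (w ρ rA : List Bool) : ℝ :=
  if A.run (boolPair (unaryEncodeNat N) (g f (w ++ ρ))) rA = w then 1 else 0

/-- `q N w r = Pr_{r_A}[A recovers w from g f (w ‖ r)]`. [folklore] -/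
noncomputable def q (N : ℕ) (w ρ : List Bool) : ℝ := uniformAvg (κA A N) fun rA => recInd f A N w ρ rA

/-- The fibre of `y` among the `n`-bit strings (as vectors). [folklore] -/
noncomputable def Sy (n : ℕ) (y : List Bool) : Finset (List.Vector Bool n) := Finset.univ.filter fun x => f x.toList = y

variable {f A}

/-- `0 ≤ ind ≤ 1`. [folklore] -/
theorem ind_nonneg (N n : ℕ) (y ib α ρ rA : List Bool) : 0 ≤ ind f A N n y ib α ρ rA := by unfold ind; split_ifs <;> norm_num
/-- `ind ≤ 1`. [folklore] -/
theorem ind_le_one (N n : ℕ) (y ib α ρ rA : List Bool) : ind f A N n y ib α ρ rA ≤ 1 := by unfold ind; split_ifs <;> norm_num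
/-- `0 ≤ recInd`. [folklore] -/
theorem recInd_nonneg (N : ℕ) (w ρ rA : List Bool) : 0 ≤ recInd f A N w ρ rA := by unfold recInd; split_ifs <;> norm_num
/-- `0 ≤ q`. [folklore] -/
theorem q_nonneg (N : ℕ) (w ρ : List Bool) : 0 ≤ q f A N w ρ := uniformAvg_nonneg fun _ => recInd_nonneg _ _ _ _
/-- `0 ≤ P`. [folklore] -/
theorem P_nonneg (N n : ℕ) (y ib : List Bool) : 0 ≤ P f A N n y ib :=
  uniformAvg_nonneg fun _ => uniformAvg_nonneg fun _ => uniformAvg_nonneg fun _ => ind_nonneg _ _ _ _ _ _ _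

/-- **The fibre of `f x₀` counted on lists equals the fibre counted on vectors.** [folklore] -/
theorem card_Sy_eq {n : ℕ} (x₀ : List.Vector Bool n) :
    (Sy f n (f x₀.toList)).card = ((allStr n).filter fun x' => f x' = f x₀.toList).card := by
  rw [← Finset.card_image_of_injective _ List.Vector.toList_injective]
  congr 1
  ext z
  simp only [Sy, Finset.mem_image, Finset.mem_filter, Finset.mem_univ, true_and, mem_allStr]
  constructor
  · rintro ⟨x, hx, rfl⟩; exact ⟨x.toList_length, hx⟩
  · rintro ⟨hz, hfz⟩; exact ⟨⟨z, hz⟩, hfz, rfl⟩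

/-- `2^{D̃(x₀)} ≤ #Sy (f x₀)`. [folklore] -/
theorem two_pow_Dtil_le_card_Sy {n : ℕ} (x₀ : List.Vector Bool n) : 2 ^ Dtil f x₀.toList ≤ (Sy f n (f x₀.toList)).card := by
  rw [card_Sy_eq]
  have h := two_pow_Dtil_le f x₀.toList
  rwa [x₀.toList_length] at h

/-- `x₀ ∈ Sy (f x₀)`, so the fibre is nonempty. [folklore] -/
theorem mem_Sy_self {n : ℕ} (x₀ : List.Vector Bool n) : x₀ ∈ Sy f n (f x₀.toList) := by simp [Sy]

/-- A function of a suffix of the coins: the leading coins average out. [folklore] -/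
private theorem uniformAvg_drop (a b : ℕ) (G : List Bool → ℝ) : uniformAvg (a + b) (fun r => G (r.drop a)) = uniformAvg b G := by
  have h := uniformAvg_add a b (fun _ w => G w)
  simp only [uniformAvg_const] at h
  exact h

/-- Iterated uniform averages commute. [folklore] -/
private theorem uniformAvg_comm (a b : ℕ) (F : List Bool → List Bool → ℝ) :
    uniformAvg a (fun u => uniformAvg b fun v => F u v) = uniformAvg b (fun v => uniformAvg a fun u => F u v) := by
  unfold uniformAvg
  simp only [Finset.sum_div, div_div]
  rw [Finset.sum_comm]
  simp_rw [mul_comm ((2 : ℝ) ^ b) ((2 : ℝ) ^ a)]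

/-- Uniform averages commute with finite sums. [folklore] -/
theorem uniformAvg_finset_sum {ι : Type*} (s : Finset ι) (k : ℕ) (F : ι → List Bool → ℝ) :
    uniformAvg k (fun r => ∑ i ∈ s, F i r) = ∑ i ∈ s, uniformAvg k (F i) := by
  unfold uniformAvg
  rw [Finset.sum_comm, Finset.sum_div]

/-- **The success of `N` on `⟨1ⁿ, y⟩` is the average of `P N n y ι` over the index block** when it holds
`d·Kb(n) + (d + hLen N + rlen N + κ N)` coins, `N = n + d` (the junk coins average out, the rest split as
`ι ‖ α ‖ r ‖ r_A`). [folklore] -/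
theorem pr_adv_eq {Kb : Polynomial ℕ} {n dd N : ℕ} (hN : n + dd = N) (hKb : dd + (hLen N + (rlen N + κA A N)) < Kb.eval n)
    {y : List Bool} {cl : ℕ → ℕ} (hcl : cl (boolPair (unaryEncodeNat n) y).length = dd * Kb.eval n + (dd + (hLen N + (rlen N + κA A N)))) :
    (adv A Kb cl).pr id (boolPair (unaryEncodeNat n) y) {z | f z = y} = uniformAvg dd fun ib => P f A N n y ib := by
  classical
  have hk : (adv A Kb cl).coinLen (id (boolPair (unaryEncodeNat n) y)).length = dd * Kb.eval n + (dd + (hLen N + (rlen N + κA A N))) := by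
    rw [id, show (adv A Kb cl).coinLen = cl from rfl, hcl]
  rw [LenPres.pr_eq_uniformAvg_ite _ id _ _ hk]
  have hrun : ∀ r : List Bool, r.length = dd * Kb.eval n + (dd + (hLen N + (rlen N + κA A N))) →
      (adv A Kb cl).run (boolPair (unaryEncodeNat n) y) r =
        (A.run (qry N y ((r.drop (dd * Kb.eval n)).take dd) (((r.drop (dd * Kb.eval n)).drop dd).take (hLen N))
          ((((r.drop (dd * Kb.eval n)).drop dd).drop (hLen N)).take (rlen N)))
          ((((r.drop (dd * Kb.eval n)).drop dd).drop (hLen N)).drop (rlen N))).take n := by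
    intro r hr
    have hdd : r.length / Kb.eval n = dd := by
      rw [hr, Nat.add_comm, Nat.add_mul_div_right _ _ (by omega), Nat.div_eq_of_lt hKb, Nat.zero_add]
    show advRun A Kb _ r = _
    simp only [advRun, boolUnpair_boolPair, length_unaryEncodeNat', hdd, hN]
  set G : List Bool → ℝ := fun w => ind f A N n y (w.take dd) ((w.drop dd).take (hLen N)) (((w.drop dd).drop (hLen N)).take (rlen N))
    (((w.drop dd).drop (hLen N)).drop (rlen N)) with hG
  rw [uniformAvg_congr (g := fun r => G (r.drop (dd * Kb.eval n)))
      (fun r hr => by simp only [Set.mem_setOf_eq, hrun r hr, hG, ind]),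
    uniformAvg_drop, hG, uniformAvg_add dd (hLen N + (rlen N + κA A N)) (fun ib w' => ind f A N n y ib (w'.take (hLen N))
      ((w'.drop (hLen N)).take (rlen N)) ((w'.drop (hLen N)).drop (rlen N)))]
  refine uniformAvg_congr fun ib _ => ?_
  rw [P, uniformAvg_add (hLen N) (rlen N + κA A N) (fun α w'' => ind f A N n y ib α (w''.take (rlen N)) (w''.drop (rlen N)))]
  refine uniformAvg_congr fun α _ => ?_
  exact uniformAvg_add (rlen N) (κA A N) fun ρ rA => ind f A N n y ib α ρ rA

/-- **`A`'s success on the hiding challenge of `(w, r)` is `q N w r`.** [folklore] -/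
theorem pr_hiding_eq (hlp : IsLengthPreserving f) {N : ℕ} (w : List.Vector Bool N) (ρ : List.Vector Bool (rlen N)) :
    A.pr id (boolPair (unaryEncodeNat N) (g f (w.toList ++ ρ.toList))) {z | z = w.toList} = q f A N w.toList ρ.toList := by
  classical
  have hk : A.coinLen (id (boolPair (unaryEncodeNat N) (g f (w.toList ++ ρ.toList)))).length = κA A N := by
    rw [id, length_boolPair, length_unaryEncodeNat', length_g hlp w.toList_length ρ.toList_length, κA]
  rw [LenPres.pr_eq_uniformAvg_ite _ id _ _ hk, q]
  rfl

/-- **The hiding probability as a sum of `q`.** [folklore] -/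
theorem hidingProb_eq (hlp : IsLengthPreserving f) (c N : ℕ) :
    hidingProb (g f) A (T f c) rlen N =
      (∑ w ∈ T f c N, ∑ ρ : List.Vector Bool (rlen N), q f A N w.toList ρ.toList) / ((T f c N).card * 2 ^ rlen N) := by
  unfold hidingProb
  simp only [pr_hiding_eq hlp]

/-- Strings of length `L` with a prescribed prefix: at least `2^{L − min k L}` of them. [folklore] -/
theorem card_prefix_ge {L k : ℕ} {μ : List Bool} (hμ : μ.length = L) :
    2 ^ (L - min k L) ≤ ((Finset.univ : Finset (List.Vector Bool L)).filter fun α => α.toList.take k = μ.take k).card := by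
  classical
  set k' := min k L with hk'
  have hμk : (μ.take k').length = k' := by rw [List.length_take, hμ]; omega
  -- the injection `t ↦ μ↾k' ‖ t`
  let ι : List.Vector Bool (L - k') → List.Vector Bool L := fun t => ⟨μ.take k' ++ t.toList, by
    rw [List.length_append, hμk, t.toList_length]; omega⟩
  have hinj : Function.Injective ι := by
    intro t t' h
    have h' := congrArg List.Vector.toList h
    exact List.Vector.toList_injective (List.append_cancel_left h')
  have hmem : ∀ t, ι t ∈ (Finset.univ : Finset (List.Vector Bool L)).filter fun α => α.toList.take k = μ.take k := by
    intro t
    simp only [Finset.mem_filter, Finset.mem_univ, true_and]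
    show (μ.take k' ++ t.toList).take k = μ.take k
    rcases le_or_gt k L with hkL | hkL
    · have hkk : k' = k := by rw [hk']; exact min_eq_left hkL
      rw [List.take_append_of_le_length (by rw [hμk, hkk]), hkk, List.take_take, min_self]
    · have hkk : k' = L := by rw [hk']; exact min_eq_right hkL.le
      have ht : t.toList = [] := List.eq_nil_of_length_eq_zero (by rw [t.toList_length, hkk]; omega)
      rw [ht, List.append_nil, hkk, List.take_take, min_eq_right hkL.le, List.take_of_length_le (by rw [hμ]),
        List.take_of_length_le (by rw [hμ]; exact hkL.le)]
  calc 2 ^ (L - k') = (Finset.univ : Finset (List.Vector Bool (L - k'))).card := by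
        rw [Finset.card_univ, card_vector, Fintype.card_bool]
    _ = ((Finset.univ : Finset (List.Vector Bool (L - k'))).image ι).card := (Finset.card_image_of_injective _ hinj).symm
    _ ≤ _ := Finset.card_le_card fun α hα => by
        obtain ⟨t, _, rfl⟩ := Finset.mem_image.1 hα
        exact hmem t

/-- **The injectivity count (the heart of the reduction).** Fix the level `N ≥ 1` (`n = n(N)`), `y`, an index
block `ι` with `⟦ι⟧ ≤ D + c` where `2^D ≤ #f⁻¹(y)`, the randomness `r` and `A`'s coins. The inputs `x ∈ f⁻¹(y)`
that `A` recovers from `⟨1^N, g f (x ‖ ι ‖ r)⟩` have pairwise distinct masked hash values, and every `α` with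
the same first `⟦ι⟧ + eLen N` bits as one of them makes `N` invert; hence
`#{recovered} ≤ 2^{⟦ι⟧ + eLen N} · Pr_α[N inverts] ≤ 2^{c + eLen N} · #f⁻¹(y) · Pr_α[N inverts]`.
[HILL 1999, Lemma 5.1.2 (1) and Lemma 6.1.1 (proofs), hiding form] [cite: HastadImpagliazzoLevinLuby1999, Lemma 5.1.2 (1) (proof) and Lemma 6.1.1 (proof)] -/
theorem sum_recovered_le {c N : ℕ} {y ib : List Bool} (hib : ib.length = bLen N) (ρ rA : List Bool) {D : ℕ} (hD : 2 ^ D ≤ (Sy f (nLen N) y).card) (hi : bitsToNat ib ≤ D + c) :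
    (∑ x ∈ Sy f (nLen N) y,
        (if A.run (qry N y ib (hashStr (nLen N) (hLen N) ρ x.toList) ρ) rA = x.toList ++ ib then (1 : ℝ) else 0)) ≤
      2 ^ (c + eLen N) * (Sy f (nLen N) y).card * uniformAvg (hLen N) fun α => ind f A N (nLen N) y ib α ρ rA := by
  classical
  set n := nLen N with hn
  set i := bitsToNat ib with hidef
  set k := i + eLen N with hk
  set H : List.Vector Bool n → List Bool := fun x => hashStr n (hLen N) ρ x.toList with hH
  have hicap : icap N ib = i := by rw [hidef]; exact icap_eq hib.le
  have hHlen : ∀ x, (H x).length = hLen N := fun x => length_hashStr ..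
  -- the recovered inputs and their masks
  set Rec := (Sy f n y).filter fun x => A.run (qry N y ib (H x) ρ) rA = x.toList ++ ib with hRec
  set Img := Rec.image fun x => maskTo N i (H x) with hImg
  have hLHS : (∑ x ∈ Sy f n y, (if A.run (qry N y ib (hashStr n (hLen N) ρ x.toList) ρ) rA = x.toList ++ ib then (1 : ℝ) else 0)) =
      Rec.card := by
    rw [hRec, Finset.card_filter, Nat.cast_sum]
    refine Finset.sum_congr rfl fun x _ => ?_
    split_ifs <;> simp
  -- the query depends on `α` only through its mask
  have hqry : ∀ α α' : List Bool, maskTo N i α = maskTo N i α' → qry N y ib α ρ = qry N y ib α' ρ := by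
    intro α α' h
    rw [qry, qry, body, body, hicap, h]
  have hinj : Set.InjOn (fun x => maskTo N i (H x)) Rec := by
    intro x hx x' hx' h
    rw [Finset.mem_coe, hRec, Finset.mem_filter] at hx hx'
    have h1 := hx.2
    rw [hqry _ _ h, hx'.2] at h1
    exact List.Vector.toList_injective (List.append_cancel_right h1).symm
  have hcard : Rec.card = Img.card := (Finset.card_image_of_injOn hinj).symm
  -- every `α` sharing the first `k` bits with a mask of a recovered input makes `N` invert
  set E : List Bool → Finset (List.Vector Bool (hLen N)) := fun μ => Finset.univ.filter fun α => α.toList.take k = μ.take k with hE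
  have hfix : ∀ μ ∈ Img, maskTo N i μ = μ ∧ μ.length = hLen N := by
    intro μ hμ
    obtain ⟨x, _, rfl⟩ := Finset.mem_image.1 hμ
    exact ⟨maskTo_maskTo (hHlen x), length_maskTo (hHlen x)⟩
  have hgood : ∀ μ ∈ Img, ∀ α ∈ E μ, ind f A N n y ib α.toList ρ rA = 1 := by
    intro μ hμ α hα
    obtain ⟨x, hx, rfl⟩ := Finset.mem_image.1 hμ
    rw [hRec, Finset.mem_filter] at hx
    have hxS := hx.1
    rw [Sy, Finset.mem_filter] at hxS
    rw [hE, Finset.mem_filter] at hα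
    have hm : maskTo N i α.toList = maskTo N i (H x) := by
      rw [maskTo_eq_of_take_eq hα.2, maskTo_maskTo (hHlen x)]
    have hrun : A.run (qry N y ib α.toList ρ) rA = x.toList ++ ib := by rw [hqry _ _ hm, hx.2]
    rw [ind, hrun, List.take_left' x.toList_length, if_pos hxS.2]
  have hdisj : (Img : Set (List Bool)).PairwiseDisjoint E := by
    intro μ hμ μ' hμ' hne
    rw [Function.onFun, Finset.disjoint_left]
    intro α hα hα'
    rw [hE, Finset.mem_filter] at hα hα'
    apply hne
    rw [← (hfix μ hμ).1, ← (hfix μ' hμ').1, ← maskTo_eq_of_take_eq hα.2, ← maskTo_eq_of_take_eq hα'.2]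
  -- count
  have h2k : (2 : ℝ) ^ hLen N ≤ 2 ^ (hLen N - min k (hLen N)) * 2 ^ k := by
    rw [← pow_add]
    exact pow_le_pow_right₀ (by norm_num) (by omega)
  have hsum : (Img.card : ℝ) * 2 ^ (hLen N - min k (hLen N)) ≤ ∑ α : List.Vector Bool (hLen N), ind f A N n y ib α.toList ρ rA := by
    calc (Img.card : ℝ) * 2 ^ (hLen N - min k (hLen N)) = ∑ μ ∈ Img, (2 : ℝ) ^ (hLen N - min k (hLen N)) := by
          rw [Finset.sum_const, nsmul_eq_mul]
      _ ≤ ∑ μ ∈ Img, ((E μ).card : ℝ) := Finset.sum_le_sum fun μ hμ => by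
          exact_mod_cast card_prefix_ge (k := k) (hfix μ hμ).2
      _ = ∑ μ ∈ Img, ∑ α ∈ E μ, ind f A N n y ib α.toList ρ rA := Finset.sum_congr rfl fun μ hμ => by
          rw [Finset.sum_congr rfl fun α hα => hgood μ hμ α hα, Finset.sum_const, nsmul_eq_mul, mul_one]
      _ = ∑ α ∈ Img.biUnion E, ind f A N n y ib α.toList ρ rA := (Finset.sum_biUnion hdisj).symm
      _ ≤ _ := Finset.sum_le_sum_of_subset_of_nonneg (Finset.subset_univ _) fun α _ _ => ind_nonneg _ _ _ _ _ _ _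
  have havg : (Img.card : ℝ) ≤ 2 ^ k * uniformAvg (hLen N) fun α => ind f A N n y ib α ρ rA := by
    unfold uniformAvg
    rw [mul_div_assoc', le_div_iff₀ (by positivity)]
    calc (Img.card : ℝ) * 2 ^ hLen N ≤ Img.card * (2 ^ (hLen N - min k (hLen N)) * 2 ^ k) :=
          mul_le_mul_of_nonneg_left h2k (Nat.cast_nonneg _)
      _ = (Img.card * 2 ^ (hLen N - min k (hLen N))) * 2 ^ k := by ring
      _ ≤ (∑ α : List.Vector Bool (hLen N), ind f A N n y ib α.toList ρ rA) * 2 ^ k :=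
          mul_le_mul_of_nonneg_right hsum (by positivity)
      _ = _ := by ring
  -- `2^k ≤ 2^{c + eLen} · #Sy`
  have hki : (2 : ℝ) ^ k ≤ 2 ^ (c + eLen N) * (Sy f n y).card := by
    have h1 : 2 ^ i ≤ 2 ^ c * (Sy f n y).card := by
      calc 2 ^ i ≤ 2 ^ (D + c) := Nat.pow_le_pow_right (by norm_num) hi
        _ = 2 ^ c * 2 ^ D := by rw [pow_add, mul_comm]
        _ ≤ 2 ^ c * (Sy f n y).card := Nat.mul_le_mul_left _ hD
    have h2 : (2 : ℝ) ^ i ≤ 2 ^ c * (Sy f n y).card := by exact_mod_cast h1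
    rw [hk, pow_add, pow_add]
    nlinarith [pow_nonneg (zero_le_two (α := ℝ)) (eLen N)]
  rw [hLHS, hcard]
  have hP0 : 0 ≤ uniformAvg (hLen N) fun α => ind f A N n y ib α ρ rA := uniformAvg_nonneg fun _ => ind_nonneg _ _ _ _ _ _ _
  calc (Img.card : ℝ) ≤ 2 ^ k * uniformAvg (hLen N) fun α => ind f A N n y ib α ρ rA := havg
    _ ≤ _ := mul_le_mul_of_nonneg_right hki hP0

end Counting

/-! ### The level inequality -/

section Level

variable {A : RandAlg (List Bool) (List Bool)}

/-- **Fibre averaging**: `Σ_{x₀} (Σ_{x ∈ f⁻¹(f x₀)} Ψ x) / #f⁻¹(f x₀) = Σ_x Ψ x`. [folklore] -/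
theorem sum_fibre_avg {n : ℕ} (Ψ : List.Vector Bool n → ℝ) :
    ∑ x₀ : List.Vector Bool n, (∑ x ∈ Sy f n (f x₀.toList), Ψ x) / (Sy f n (f x₀.toList)).card = ∑ x, Ψ x := by
  classical
  simp only [Finset.sum_div]
  rw [Finset.sum_comm' (t' := Finset.univ) (s' := fun x => Sy f n (f x.toList)) (fun x₀ x => by
    simp only [Sy, Finset.mem_filter, Finset.mem_univ, true_and, and_true]; exact eq_comm)]
  refine Finset.sum_congr rfl fun x _ => ?_
  have hc : ∀ x₀ ∈ Sy f n (f x.toList), (Sy f n (f x₀.toList)).card = (Sy f n (f x.toList)).card := fun x₀ hx₀ => by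
    rw [Sy, Finset.mem_filter] at hx₀; rw [hx₀.2]
  rw [Finset.sum_congr rfl fun x₀ hx₀ => by rw [hc x₀ hx₀], Finset.sum_const, nsmul_eq_mul]
  have hpos : (0 : ℝ) < (Sy f n (f x.toList)).card := by exact_mod_cast Finset.card_pos.2 ⟨x, mem_Sy_self x⟩
  field_simp

/-- Sums over `{0,1}^N` split as sums over `{0,1}^a × {0,1}^b` when `a + b = N`. [folklore] -/
theorem sum_vector_eq_sum_append {M : Type*} [AddCommMonoid M] {a b N : ℕ} (h : a + b = N) (φ : List Bool → M) :
    ∑ w : List.Vector Bool N, φ w.toList = ∑ u : List.Vector Bool a, ∑ v : List.Vector Bool b, φ (u.toList ++ v.toList) := by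
  subst h
  rw [← sum_vector_add (M := M) a b fun u v => φ (u ++ v)]
  exact Finset.sum_congr rfl fun w _ => by rw [List.take_append_drop]

/-- **The recovering probabilities, sliced**: for `x₀`, an index block `ι` with `⟦ι⟧ ≤ D̃(x₀) + c`,
`(Σ_{x ∈ f⁻¹(f x₀)} Pr_{r, r_A}[A recovers x ‖ ι]) / (2^{c + eLen N} #f⁻¹(f x₀)) ≤ P N n (f x₀) ι`. [HILL 1999, Lemma
6.1.1 (proof), hiding form] [cite: HastadImpagliazzoLevinLuby1999, Lemma 6.1.1 (proof)] -/
theorem P_ge {c N : ℕ} (hN1 : 1 ≤ N) (x₀ : List.Vector Bool (nLen N)) (ib : List.Vector Bool (bLen N))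
    (hi : bitsToNat ib.toList ≤ Dtil f x₀.toList + c) :
    (∑ x ∈ Sy f (nLen N) (f x₀.toList), uniformAvg (rlen N) fun ρ => q f A N (x.toList ++ ib.toList) ρ) /
        (2 ^ (c + eLen N) * (Sy f (nLen N) (f x₀.toList)).card) ≤ P f A N (nLen N) (f x₀.toList) ib.toList := by
  classical
  set y := f x₀.toList with hy
  set S := Sy f (nLen N) y with hS
  set C : ℝ := 2 ^ (c + eLen N) * S.card with hC
  have hSpos : (0 : ℝ) < S.card := by exact_mod_cast Finset.card_pos.2 ⟨x₀, mem_Sy_self x₀⟩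
  have hCpos : 0 < C := by rw [hC]; positivity
  set recI : List.Vector Bool (nLen N) → List Bool → List Bool → ℝ := fun x ρ rA =>
    if A.run (qry N y ib.toList (hashStr (nLen N) (hLen N) ρ x.toList) ρ) rA = x.toList ++ ib.toList then 1 else 0 with hrecI
  -- reorder the averages in `P`
  have hcomm : P f A N (nLen N) y ib.toList =
      uniformAvg (rlen N) fun ρ => uniformAvg (κA A N) fun rA => uniformAvg (hLen N) fun α => ind f A N (nLen N) y ib.toList α ρ rA := by
    rw [P, uniformAvg_comm]
    exact uniformAvg_congr fun ρ _ => uniformAvg_comm _ _ _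
  -- the pointwise bound from the injectivity count
  have hlow : ∀ ρ rA : List Bool, C⁻¹ * ∑ x ∈ S, recI x ρ rA ≤ uniformAvg (hLen N) fun α => ind f A N (nLen N) y ib.toList α ρ rA := by
    intro ρ rA
    have h := sum_recovered_le (f := f) (A := A) (c := c) (N := N) (y := y) ib.toList_length ρ rA (two_pow_Dtil_le_card_Sy x₀) hi
    rw [inv_mul_le_iff₀ hCpos, hC]
    exact h
  -- `A`'s conditional success on `x ‖ ι` is `recI` averaged
  have hq : ∀ x ∈ S, ∀ ρ : List Bool, ρ.length = rlen N →
      uniformAvg (κA A N) (fun rA => recI x ρ rA) = q f A N (x.toList ++ ib.toList) ρ := by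
    intro x hx ρ hρ
    rw [hS, Sy, Finset.mem_filter] at hx
    have hch := challenge_eq (f := f) (N := N) x.toList_length (by rw [ib.toList_length, ibLen_eq hN1]) hρ
    rw [q]
    refine uniformAvg_congr fun rA _ => ?_
    simp only [hrecI, recInd, hch, hx.2]
  calc (∑ x ∈ S, uniformAvg (rlen N) fun ρ => q f A N (x.toList ++ ib.toList) ρ) / C
      = C⁻¹ * ∑ x ∈ S, uniformAvg (rlen N) fun ρ => uniformAvg (κA A N) fun rA => recI x ρ rA := by
        rw [div_eq_inv_mul]
        congr 1
        exact Finset.sum_congr rfl fun x hx => uniformAvg_congr fun ρ hρ => (hq x hx ρ hρ).symm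
    _ = uniformAvg (rlen N) fun ρ => uniformAvg (κA A N) fun rA => C⁻¹ * ∑ x ∈ S, recI x ρ rA := by
        rw [← uniformAvg_finset_sum, ← uniformAvg_const_mul]
        refine uniformAvg_congr fun ρ _ => ?_
        rw [← uniformAvg_finset_sum, ← uniformAvg_const_mul]
    _ ≤ uniformAvg (rlen N) fun ρ => uniformAvg (κA A N) fun rA => uniformAvg (hLen N) fun α => ind f A N (nLen N) y ib.toList α ρ rA :=
        uniformAvg_mono fun ρ _ => uniformAvg_mono fun rA _ => hlow ρ rA
    _ = P f A N (nLen N) y ib.toList := hcomm.symm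

/-- `#𝒯_c ≥ 2^{n(N)}` (the inputs `x ‖ 0^{b(N)}`). [folklore] -/
theorem two_pow_le_card_T (c : ℕ) {N : ℕ} (hN1 : 1 ≤ N) : 2 ^ nLen N ≤ (T f c N).card := by
  classical
  have hlen : ∀ x : List.Vector Bool (nLen N), (x.toList ++ List.replicate (bLen N) false).length = N := fun x => by
    rw [List.length_append, x.toList_length, List.length_replicate, nLen_add_bLen hN1]
  let ι : List.Vector Bool (nLen N) → List.Vector Bool N := fun x => ⟨x.toList ++ List.replicate (bLen N) false, hlen x⟩
  have hinj : Function.Injective ι := fun x x' h => by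
    have h' := congrArg List.Vector.toList h
    exact List.Vector.toList_injective (List.append_cancel_right h')
  have hmem : ∀ x, ι x ∈ T f c N := fun x => by
    rw [mem_T]
    have hib : (List.replicate (bLen N) false).length = ibLen N := by rw [List.length_replicate, ibLen_eq hN1]
    show iOf (x.toList ++ List.replicate (bLen N) false) ≤ Dtil f (xOf (x.toList ++ List.replicate (bLen N) false)) + c
    rw [iOf, iBits_append x.toList_length hib, bitsToNat_replicate_false]
    exact Nat.zero_le _
  calc 2 ^ nLen N = (Finset.univ : Finset (List.Vector Bool (nLen N))).card := by rw [Finset.card_univ, card_vector, Fintype.card_bool]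
    _ = ((Finset.univ : Finset (List.Vector Bool (nLen N))).image ι).card := (Finset.card_image_of_injective _ hinj).symm
    _ ≤ _ := Finset.card_le_card fun w hw => by
        obtain ⟨x, _, rfl⟩ := Finset.mem_image.1 hw
        exact hmem x

/-- **The level inequality**: when `N` holds `b(N)·Kb(n) + (b(N) + hLen N + rlen N + κ N)` coins on the challenges
of length `n = n(N)` (so that it aims at level `N`), `hidingProb(N) ≤ 2^{b(N) + c + eLen N} · Pr[N inverts f on U_n]`.
[HILL 1999, Lemma 6.1.1 (proof: "N^A(f(X)) produces an inverse with probability at least 1/n times …"), hiding form]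
[cite: HastadImpagliazzoLevinLuby1999, Lemma 6.1.1 (proof)] -/
theorem hidingProb_le (hlp : IsLengthPreserving f) {c N : ℕ} (hN1 : 1 ≤ N) {Kb : Polynomial ℕ}
    (hKb : bLen N + (hLen N + (rlen N + κA A N)) < Kb.eval (nLen N)) {cl : ℕ → ℕ}
    (hcl : ∀ x : List Bool, x.length = nLen N →
      cl (boolPair (unaryEncodeNat (nLen N)) (f x)).length = bLen N * Kb.eval (nLen N) + (bLen N + (hLen N + (rlen N + κA A N)))) :
    hidingProb (g f) A (T f c) rlen N ≤ 2 ^ (bLen N + c + eLen N) * invertProb f (adv A Kb cl) (nLen N) := by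
  classical
  set n := nLen N with hn
  set dd := bLen N with hdd
  have hndd : n + dd = N := nLen_add_bLen hN1
  set C : ℝ := 2 ^ (c + eLen N) with hC
  have hCpos : 0 < C := by rw [hC]; positivity
  -- the quantities
  set Qx : List.Vector Bool n → List.Vector Bool dd → ℝ := fun x ib => uniformAvg (rlen N) fun ρ => q f A N (x.toList ++ ib.toList) ρ with hQx
  set slice : List.Vector Bool n → Finset (List.Vector Bool dd) := fun x => Finset.univ.filter fun ib => bitsToNat ib.toList ≤ Dtil f x.toList + c
    with hslice
  set Ψ : List.Vector Bool n → ℝ := fun x => ∑ ib ∈ slice x, Qx x ib with hΨ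
  have hQx0 : ∀ x ib, 0 ≤ Qx x ib := fun x ib => uniformAvg_nonneg fun _ => q_nonneg _ _ _
  have hΨ0 : ∀ x, 0 ≤ Ψ x := fun x => Finset.sum_nonneg fun ib _ => hQx0 x ib
  -- Step 1: `invertProb` as a double average of `P`
  have hinv : invertProb f (adv A Kb cl) n = uniformAvg n fun x₀ => uniformAvg dd fun ib => P f A N n (f x₀) ib := by
    rw [invertProb]
    exact uniformAvg_congr fun x hx => pr_adv_eq hndd hKb (hcl x hx)
  -- Step 2: slice and bound each term
  have hstep : ∀ x₀ : List.Vector Bool n,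
      C⁻¹ * ((∑ x ∈ Sy f n (f x₀.toList), Ψ x) / (Sy f n (f x₀.toList)).card) ≤ 2 ^ dd * uniformAvg dd fun ib => P f A N n (f x₀.toList) ib := by
    intro x₀
    have hSpos : (0 : ℝ) < (Sy f n (f x₀.toList)).card := by exact_mod_cast Finset.card_pos.2 ⟨x₀, mem_Sy_self x₀⟩
    -- rewrite the fibre sum with the slice of `x₀` (it only depends on `f x`)
    have hΨeq : ∀ x ∈ Sy f n (f x₀.toList), Ψ x = ∑ ib ∈ slice x₀, Qx x ib := by
      intro x hx
      rw [Sy, Finset.mem_filter] at hx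
      have hsl : slice x = slice x₀ := by
        rw [hslice]; dsimp only
        rw [Dtil_congr (by rw [x.toList_length, x₀.toList_length]) hx.2]
      rw [hΨ]; dsimp only; rw [hsl]
    rw [Finset.sum_congr rfl hΨeq, Finset.sum_comm]
    -- now `Σ_{ib ∈ slice x₀} Σ_{x ∈ Sy} Qx x ib`
    have hPge : ∀ ib ∈ slice x₀, (∑ x ∈ Sy f n (f x₀.toList), Qx x ib) / (C * (Sy f n (f x₀.toList)).card) ≤ P f A N n (f x₀.toList) ib.toList := by
      intro ib hib
      rw [hslice, Finset.mem_filter] at hib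
      exact P_ge hN1 x₀ ib hib.2
    calc C⁻¹ * ((∑ ib ∈ slice x₀, ∑ x ∈ Sy f n (f x₀.toList), Qx x ib) / (Sy f n (f x₀.toList)).card)
        = ∑ ib ∈ slice x₀, (∑ x ∈ Sy f n (f x₀.toList), Qx x ib) / (C * (Sy f n (f x₀.toList)).card) := by
          rw [Finset.sum_div, Finset.mul_sum]
          exact Finset.sum_congr rfl fun ib _ => by field_simp
      _ ≤ ∑ ib ∈ slice x₀, P f A N n (f x₀.toList) ib.toList := Finset.sum_le_sum hPge
      _ ≤ ∑ ib : List.Vector Bool dd, P f A N n (f x₀.toList) ib.toList :=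
          Finset.sum_le_sum_of_subset_of_nonneg (Finset.subset_univ _) fun ib _ _ => P_nonneg _ _ _ _
      _ = 2 ^ dd * uniformAvg dd fun ib => P f A N n (f x₀.toList) ib := by
          unfold uniformAvg; field_simp
  -- Step 3: sum over `x₀`, fibre averaging
  have hsum : C⁻¹ * ∑ x : List.Vector Bool n, Ψ x ≤ 2 ^ dd * 2 ^ n * invertProb f (adv A Kb cl) n := by
    rw [← sum_fibre_avg (f := f) Ψ, Finset.mul_sum, hinv]
    calc ∑ x₀ : List.Vector Bool n, C⁻¹ * ((∑ x ∈ Sy f n (f x₀.toList), Ψ x) / (Sy f n (f x₀.toList)).card)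
        ≤ ∑ x₀ : List.Vector Bool n, 2 ^ dd * uniformAvg dd fun ib => P f A N n (f x₀.toList) ib := Finset.sum_le_sum fun x₀ _ => hstep x₀
      _ = 2 ^ dd * 2 ^ n * uniformAvg n fun x₀ => uniformAvg dd fun ib => P f A N n (f x₀) ib := by
          unfold uniformAvg; rw [← Finset.mul_sum]; field_simp
  -- Step 4: `Σ_x Ψ x = Σ_{w ∈ 𝒯} avg_r q = hidingProb · #𝒯`
  have hT : ∑ x : List.Vector Bool n, Ψ x = hidingProb (g f) A (T f c) rlen N * (T f c N).card := by
    have h1 : ∑ x : List.Vector Bool n, Ψ x =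
        ∑ w : List.Vector Bool N, (if iOf w.toList ≤ Dtil f (xOf w.toList) + c then uniformAvg (rlen N) (fun ρ => q f A N w.toList ρ) else 0) := by
      rw [sum_vector_eq_sum_append (M := ℝ) hndd fun w => if iOf w ≤ Dtil f (xOf w) + c then uniformAvg (rlen N) (fun ρ => q f A N w ρ) else 0]
      refine Finset.sum_congr rfl fun x _ => ?_
      rw [hΨ, hslice]; dsimp only
      rw [Finset.sum_filter]
      refine Finset.sum_congr rfl fun ib _ => ?_
      have hibl : ib.toList.length = ibLen N := by rw [ib.toList_length, ibLen_eq hN1]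
      rw [iOf, iBits_append x.toList_length hibl, xOf_append x.toList_length hibl]
    have h2 : ∑ w : List.Vector Bool N, (if iOf w.toList ≤ Dtil f (xOf w.toList) + c then uniformAvg (rlen N) (fun ρ => q f A N w.toList ρ) else 0) =
        ∑ w ∈ T f c N, uniformAvg (rlen N) fun ρ => q f A N w.toList ρ := by
      rw [← Finset.sum_filter]; rfl
    have hTpos : (0 : ℝ) < (T f c N).card := by exact_mod_cast (T_nonempty f c N).card_pos
    rw [h1, h2, hidingProb_eq hlp c N]
    have h3 : (∑ w ∈ T f c N, ∑ ρ : List.Vector Bool (rlen N), q f A N w.toList ρ.toList) / ((T f c N).card * 2 ^ rlen N) * (T f c N).card =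
        (∑ w ∈ T f c N, ∑ ρ : List.Vector Bool (rlen N), q f A N w.toList ρ.toList) / 2 ^ rlen N := by
      field_simp
    rw [h3, Finset.sum_div]
    simp only [uniformAvg]
  -- Step 5: assemble
  have hTcard : (2 : ℝ) ^ n ≤ (T f c N).card := by exact_mod_cast two_pow_le_card_T (f := f) c hN1
  have hhp0 : 0 ≤ hidingProb (g f) A (T f c) rlen N := hidingProb_nonneg _ _ _ _ _
  have hI0 : 0 ≤ invertProb f (adv A Kb cl) n := invertProb_nonneg _ _ _
  rw [hT] at hsum
  -- `C⁻¹ · hp · #T ≤ 2^dd 2^n I` and `#T ≥ 2^n` give `hp ≤ 2^{dd} C I`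
  have h1 : hidingProb (g f) A (T f c) rlen N * 2 ^ n ≤ C * (2 ^ dd * 2 ^ n * invertProb f (adv A Kb cl) n) := by
    have := mul_le_mul_of_nonneg_left hsum hCpos.le
    rw [← mul_assoc, mul_inv_cancel₀ hCpos.ne', one_mul] at this
    exact (mul_le_mul_of_nonneg_left hTcard hhp0).trans this
  have h2n : (0 : ℝ) < 2 ^ n := by positivity
  rw [show bLen N + c + eLen N = dd + (c + eLen N) by rw [hdd]; ring, pow_add, ← hC]
  nlinarith

end Level

/-! ### Hiding over `𝒯_c` -/

section MainHiding

/-- A nonnegative sequence that is not negligible is at least `1/n^k` infinitely often. [Goldreich 2001, §1.3.5]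
[folklore] -/
private theorem exists_frequently_ge_of_not_spd {u : ℕ → ℝ} (h0 : ∀ n, 0 ≤ u n)
    (h : ¬ SuperpolynomialDecay atTop (fun n : ℕ => (n : ℝ)) u) :
    ∃ k : ℕ, ∃ᶠ n : ℕ in atTop, 1 / (n : ℝ) ^ k ≤ u n := by
  have h' := (isNegligible_iff_eventually_lt_of_nonneg h0).not.1 h
  push Not at h'
  obtain ⟨c, hc⟩ := h'
  exact ⟨c, by simpa [Filter.not_eventually, not_lt] using hc⟩

/-- **HILL's `f'` is hiding over `𝒯_c` (Lemma 6.1.1, inversion part, hiding form).** For a length-preserving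
one-way `f` and every `c`, no PPT algorithm recovers `w = x ‖ ι` from `⟨1^N, g f (w ‖ r)⟩` for `w ← 𝒯_c`
with non-negligible probability: a recoverer succeeding with probability `≥ 1/N^k` on infinitely many levels
`N` is run by the inverter `N` (uniform `ι, α, r`; the level above `n` and `A`'s coin count carried by the coin
budget), which then inverts `f` on `U_{n(N)}` with probability `≥ 1/(N^k · 2^{b(N)+c+eLen(N)})`
(`hidingProb_le`) — polynomially related to `n(N) ≥ (N−2)/2` — contradicting the one-wayness of `f`.
[cite: HastadImpagliazzoLevinLuby1999, Lemma 6.1.1 with Lemma 5.1.2 (1)] -/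
theorem isHidingOver_g (hf : IsOneWay f) (hlp : IsLengthPreserving f) (c : ℕ) : IsHidingOver (g f) (T f c) rlen := by
  intro A hA
  by_contra hns
  obtain ⟨k, hfreq⟩ := exists_frequently_ge_of_not_spd (fun N => hidingProb_nonneg _ A _ _ N) hns
  obtain ⟨qA, hqA⟩ := hA.2
  -- good levels and the level choice above each `n`
  set Good : ℕ → Prop := fun N => 1 ≤ N ∧ 1 / (N : ℝ) ^ k ≤ hidingProb (g f) A (T f c) rlen N with hGood
  have hgood : ∃ᶠ N in atTop, Good N := (hfreq.and_eventually (eventually_ge_atTop 1)).mono fun N hN => ⟨hN.2, hN.1⟩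
  classical
  let Nst : ℕ → ℕ := fun n => if h : ∃ N, Good N ∧ nLen N = n then Classical.choose h else n
  have hNst : ∀ n, n ≤ Nst n ∧ Nst n ≤ 2 * n + 2 := by
    intro n
    by_cases h : ∃ N, Good N ∧ nLen N = n
    · have hs := Classical.choose_spec h
      simp only [Nst, dif_pos h]
      refine ⟨?_, ?_⟩
      · conv_lhs => rw [← hs.2]
        exact nLen_le _
      · have := le_two_mul_nLen (Classical.choose h)
        rw [hs.2] at this
        exact this
    · simp only [Nst, dif_neg h]; omega
  have hNst_good : ∀ n, (∃ N, Good N ∧ nLen N = n) → Good (Nst n) ∧ nLen (Nst n) = n := by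
    intro n h
    simp only [Nst, dif_pos h]
    exact Classical.choose_spec h
  -- the inverter
  have hPPT : IsPPT (adv A (Kb qA) (cl A qA Nst)) id := adv_isPPT hA ⟨(X + C 3) * Kb qA, cl_le hqA hNst⟩
  have hdec := hf.2 _ hPPT
  -- on good `n` the inverter does well
  have hlow : ∀ n, (∃ N, Good N ∧ nLen N = n) →
      1 / (((2 * n + 2 : ℕ) : ℝ) ^ k * 2 ^ (c + 3 * (Nat.log 2 (2 * n + 2) + 1) + 4)) ≤ invertProb f (adv A (Kb qA) (cl A qA Nst)) n := by
    intro n hn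
    obtain ⟨⟨hN1, hhp⟩, hnl⟩ := hNst_good n hn
    set N := Nst n with hNdef
    have hb : bLen N = N - n := by have := nLen_add_bLen hN1; omega
    have hKb : bLen N + (hLen N + (rlen N + κA A N)) < (Kb qA).eval (nLen N) := by
      rw [hb, hnl]; exact lt_Kb hqA (hNst n).1 (hNst n).2
    have hclx : ∀ x : List Bool, x.length = nLen N →
        cl A qA Nst (boolPair (unaryEncodeNat (nLen N)) (f x)).length = bLen N * (Kb qA).eval (nLen N) + (bLen N + (hLen N + (rlen N + κA A N))) := by
      intro x hx
      rw [cl_eq hlp hx, Code, hnl, ← hNdef, hb]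
    have hlev := hidingProb_le (A := A) hlp (c := c) hN1 hKb hclx
    rw [hnl] at hlev
    -- `1/N^k ≤ hp ≤ 2^{b+c+e} I`
    have hN2 : N ≤ 2 * n + 2 := (hNst n).2
    have hNpos : (0 : ℝ) < N := by exact_mod_cast hN1
    have hpow : (2 : ℝ) ^ (bLen N + c + eLen N) ≤ 2 ^ (c + 3 * (Nat.log 2 (2 * n + 2) + 1) + 4) := by
      refine pow_le_pow_right₀ (by norm_num) ?_
      have : bLen N ≤ Nat.log 2 (2 * n + 2) + 1 := by
        unfold bLen; exact Nat.succ_le_succ (Nat.log_mono_right hN2)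
      unfold eLen; omega
    have hNk : (1 : ℝ) / ((2 * n + 2 : ℕ) : ℝ) ^ k ≤ 1 / (N : ℝ) ^ k := by
      refine one_div_le_one_div_of_le (pow_pos hNpos k) (pow_le_pow_left₀ hNpos.le (by exact_mod_cast hN2) k)
    have hI0 : 0 ≤ invertProb f (adv A (Kb qA) (cl A qA Nst)) n := invertProb_nonneg _ _ _
    have h2pos : (0 : ℝ) < 2 ^ (bLen N + c + eLen N) := by positivity
    have h2pos' : (0 : ℝ) < 2 ^ (c + 3 * (Nat.log 2 (2 * n + 2) + 1) + 4) := by positivity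
    rw [one_div, mul_inv, ← one_div, ← one_div]
    calc 1 / (((2 * n + 2 : ℕ) : ℝ)) ^ k * (1 / 2 ^ (c + 3 * (Nat.log 2 (2 * n + 2) + 1) + 4))
        ≤ 1 / (N : ℝ) ^ k * (1 / 2 ^ (bLen N + c + eLen N)) :=
          mul_le_mul hNk (one_div_le_one_div_of_le h2pos hpow) (by positivity) (by positivity)
      _ ≤ hidingProb (g f) A (T f c) rlen N * (1 / 2 ^ (bLen N + c + eLen N)) := mul_le_mul_of_nonneg_right hhp (by positivity)
      _ ≤ _ := by
          rw [mul_one_div, div_le_iff₀ h2pos, mul_comm]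
          exact hlev
  -- good `n` are unbounded
  have hgoodn : ∀ a, ∃ n, a ≤ n ∧ ∃ N, Good N ∧ nLen N = n := by
    intro a
    obtain ⟨N, hN, hG⟩ := frequently_atTop.1 hgood (2 * a + 2)
    refine ⟨nLen N, ?_, N, hG, rfl⟩
    have := le_two_mul_nLen N
    omega
  -- but `n^{k+4} · Pr[N inverts f on U_n] → 0`
  have ht : Tendsto (fun n : ℕ => (n : ℝ) ^ (k + 4) * invertProb f (adv A (Kb qA) (cl A qA Nst)) n) atTop (nhds 0) :=
    hdec (k + 4)
  set ε : ℝ := 1 / ((4 : ℝ) ^ k * 2 ^ (c + 10) * 1000) with hε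
  have hεpos : 0 < ε := by rw [hε]; positivity
  obtain ⟨M, hM⟩ := eventually_atTop.1 ((tendsto_order.1 ht).2 ε hεpos)
  obtain ⟨n, hMn, hn⟩ := hgoodn (max M 1)
  have hn1 : 1 ≤ n := le_of_max_le_right hMn
  have h1 := hM n (le_of_max_le_left hMn)
  have h2 := hlow n hn
  -- arithmetic: `n^{k+4} / ((2n+2)^k · 2^{c + 3(log(2n+2)+1) + 4}) ≥ ε`
  have hnR : (1 : ℝ) ≤ n := by exact_mod_cast hn1
  have hlog : (2 : ℝ) ^ (Nat.log 2 (2 * n + 2)) ≤ 2 * n + 2 := by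
    have := Nat.pow_log_le_self 2 (show 2 * n + 2 ≠ 0 by omega)
    exact_mod_cast this
  have hI0 : 0 ≤ invertProb f (adv A (Kb qA) (cl A qA Nst)) n := invertProb_nonneg _ _ _
  set I := invertProb f (adv A (Kb qA) (cl A qA Nst)) n with hI
  set L2 : ℝ := (2 : ℝ) ^ (Nat.log 2 (2 * n + 2)) with hL2
  have hL2pos : 0 < L2 := by rw [hL2]; positivity
  -- rewrite the power of two
  have hpow : (2 : ℝ) ^ (c + 3 * (Nat.log 2 (2 * n + 2) + 1) + 4) = 2 ^ (c + 7) * L2 ^ 3 := by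
    rw [hL2, ← pow_mul, show c + 3 * (Nat.log 2 (2 * n + 2) + 1) + 4 = (c + 7) + Nat.log 2 (2 * n + 2) * 3 by ring, pow_add]
  have hcast : (((2 * n + 2 : ℕ) : ℝ)) = 2 * n + 2 := by push_cast; ring
  rw [hpow, hcast] at h2
  -- from h2: `1 ≤ I · (2n+2)^k · 2^{c+7} · L2³`
  have hden : (0 : ℝ) < (2 * n + 2) ^ k * (2 ^ (c + 7) * L2 ^ 3) := by positivity
  rw [div_le_iff₀ hden] at h2
  -- bounds: `(2n+2)^k ≤ 4^k n^k`, `L2 ≤ 2n+2 ≤ 4n`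
  have hb1 : (2 * (n : ℝ) + 2) ^ k ≤ (4 : ℝ) ^ k * n ^ k := by
    rw [← mul_pow]; exact pow_le_pow_left₀ (by positivity) (by linarith) k
  have hb2 : L2 ^ 3 ≤ 64 * (n : ℝ) ^ 3 := by
    have : L2 ≤ 4 * n := hlog.trans (by linarith)
    calc L2 ^ 3 ≤ (4 * (n : ℝ)) ^ 3 := pow_le_pow_left₀ hL2pos.le this 3
      _ = 64 * n ^ 3 := by ring
  have h3 : 1 ≤ I * ((4 : ℝ) ^ k * n ^ k * (2 ^ (c + 7) * (64 * n ^ 3))) := by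
    refine h2.trans (mul_le_mul_of_nonneg_left ?_ hI0)
    exact mul_le_mul hb1 (mul_le_mul_of_nonneg_left hb2 (by positivity)) (by positivity) (by positivity)
  -- `h1 : n^{k+4} I < ε`
  have h4 : (n : ℝ) ^ (k + 4) * I < ε := h1
  set Xq : ℝ := I * (4 : ℝ) ^ k * n ^ k * 2 ^ (c + 7) * n ^ 3 with hXq
  have hX0 : 0 ≤ Xq := by rw [hXq]; positivity
  have hX3 : 1 ≤ 64 * Xq := by rw [hXq]; nlinarith [h3]
  have hX4 : 8000 * (n * Xq) < 1 := by
    rw [hε, lt_div_iff₀ (by positivity)] at h4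
    have : (n : ℝ) ^ (k + 4) * I * ((4 : ℝ) ^ k * 2 ^ (c + 10) * 1000) = 8000 * (n * Xq) := by
      rw [hXq]; ring
    linarith [this ▸ h4]
  have hnX : Xq ≤ n * Xq := le_mul_of_one_le_left hX0 hnR
  nlinarith

end MainHiding

end HILL

/-! ### Hiding passes to comparable subfamilies -/

/-- **Hiding over `S'` implies hiding over a subfamily `S ⊆ S'` of comparable size** (`#S' ≤ C·#S`): the
recovering probability over `S` is at most `C` times that over `S'`. (Used with HILL's enlarged `𝒯` of
prescribed density, `𝒯 ⊆ 𝒯̃ ⊆ 𝒯_1`.) [cite: HastadImpagliazzoLevinLuby1999, §6.3 (last paragraph: enlarging 𝒯)] -/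
theorem IsHidingOver.of_subset {g : List Bool → List Bool} {S S' : ∀ n : ℕ, Finset (List.Vector Bool n)} {m : ℕ → ℕ}
    (h : IsHidingOver g S' m) (C : ℕ) (hsub : ∀ n, S n ⊆ S' n) (hcard : ∀ n, (S' n).card ≤ C * (S n).card) :
    IsHidingOver g S m := by
  intro A hA
  have hle : ∀ n, hidingProb g A S m n ≤ C * hidingProb g A S' m n := by
    intro n
    unfold hidingProb
    rcases Nat.eq_zero_or_pos (S n).card with h0 | hpos
    · rw [h0, Nat.cast_zero, zero_mul, div_zero]
      exact mul_nonneg (Nat.cast_nonneg _) (div_nonneg (Finset.sum_nonneg fun _ _ => Finset.sum_nonneg fun _ _ => A.pr_nonneg _ _ _) (by positivity))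
    · have hS : (0 : ℝ) < (S n).card := by exact_mod_cast hpos
      have hS' : (0 : ℝ) < (S' n).card := by exact_mod_cast hpos.trans_le (Finset.card_le_card (hsub n))
      have hnum : (∑ x ∈ S n, ∑ ρ : List.Vector Bool (m n), A.pr id (boolPair (unaryEncodeNat n) (g (x.toList ++ ρ.toList))) {z | z = x.toList}) ≤
          ∑ x ∈ S' n, ∑ ρ : List.Vector Bool (m n), A.pr id (boolPair (unaryEncodeNat n) (g (x.toList ++ ρ.toList))) {z | z = x.toList} :=
        Finset.sum_le_sum_of_subset_of_nonneg (hsub n) fun _ _ _ => Finset.sum_nonneg fun _ _ => A.pr_nonneg _ _ _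
      have hC : ((S' n).card : ℝ) ≤ C * (S n).card := by exact_mod_cast hcard n
      rw [div_le_iff₀ (by positivity)]
      calc (∑ x ∈ S n, ∑ ρ : List.Vector Bool (m n), A.pr id (boolPair (unaryEncodeNat n) (g (x.toList ++ ρ.toList))) {z | z = x.toList})
          ≤ ∑ x ∈ S' n, ∑ ρ : List.Vector Bool (m n), A.pr id (boolPair (unaryEncodeNat n) (g (x.toList ++ ρ.toList))) {z | z = x.toList} := hnum
        _ = (∑ x ∈ S' n, ∑ ρ : List.Vector Bool (m n), A.pr id (boolPair (unaryEncodeNat n) (g (x.toList ++ ρ.toList))) {z | z = x.toList}) /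
              ((S' n).card * 2 ^ m n) * ((S' n).card * 2 ^ m n) := by field_simp
        _ ≤ (∑ x ∈ S' n, ∑ ρ : List.Vector Bool (m n), A.pr id (boolPair (unaryEncodeNat n) (g (x.toList ++ ρ.toList))) {z | z = x.toList}) /
              ((S' n).card * 2 ^ m n) * ((C * (S n).card) * 2 ^ m n) :=
            mul_le_mul_of_nonneg_left (mul_le_mul_of_nonneg_right hC (by positivity))
              (div_nonneg (Finset.sum_nonneg fun _ _ => Finset.sum_nonneg fun _ _ => A.pr_nonneg _ _ _) (by positivity))
        _ = _ := by ring
  have h' := (h A hA).const_mul (C : ℝ)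
  refine h'.trans_abs_le fun n => ?_
  rw [abs_of_nonneg (hidingProb_nonneg _ _ _ _ _), abs_of_nonneg (mul_nonneg (Nat.cast_nonneg _) (hidingProb_nonneg _ _ _ _ _))]
  exact hle n

/-- Bit strings of equal length with equal values are equal. [folklore] -/
private theorem HILL.bits_eq_of_bitsToNat_eq : ∀ {v w : List Bool}, v.length = w.length → bitsToNat v = bitsToNat w → v = w
  | [], [], _, _ => rfl
  | [], _ :: _, h, _ => by simp at h
  | _ :: _, [], h, _ => by simp at h
  | a :: v, b :: w, h, hv => by
    simp only [List.length_cons, Nat.succ.injEq] at h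
    rw [bitsToNat_cons, bitsToNat_cons] at hv
    have hab : a = b := by
      cases a <;> cases b <;> simp [Bool.toNat] at hv ⊢ <;> omega
    subst hab
    have hvw : bitsToNat v = bitsToNat w := by omega
    rw [HILL.bits_eq_of_bitsToNat_eq h hvw]

/-- `#𝒯_{c+1} ≤ 2 · #𝒯_c` (each fibre layer `i ≤ D̃ + c + 1` has at most twice as many index blocks as `i ≤ D̃ + c`…
in fact at most `(D̃+c+2)/(D̃+c+1) ≤ 2` times). [folklore] -/
theorem HILL.card_T_succ_le (f : List Bool → List Bool) (c N : ℕ) : (HILL.T f (c + 1) N).card ≤ 2 * (HILL.T f c N).card := by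
  classical
  -- split `𝒯_{c+1} = 𝒯_c ∪ {⟦ι⟧ = D̃ + c + 1}` and inject the new layer into `𝒯_c` by `ι ↦ 0`
  have hsplit : HILL.T f (c + 1) N ⊆ HILL.T f c N ∪ (Finset.univ.filter fun w : List.Vector Bool N =>
      HILL.iOf w.toList = HILL.Dtil f (HILL.xOf w.toList) + c + 1) := by
    intro w hw
    rw [HILL.mem_T] at hw
    rw [Finset.mem_union, HILL.mem_T, Finset.mem_filter]
    rcases Nat.lt_or_ge (HILL.iOf w.toList) (HILL.Dtil f (HILL.xOf w.toList) + c + 1) with h | h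
    · left; omega
    · right; exact ⟨Finset.mem_univ _, by omega⟩
  -- the layer injects into `𝒯_c`: replace the index block by zeros
  set layer := (Finset.univ.filter fun w : List.Vector Bool N => HILL.iOf w.toList = HILL.Dtil f (HILL.xOf w.toList) + c + 1) with hlayer
  have hlen : ∀ w : List.Vector Bool N, (HILL.xOf w.toList ++ List.replicate (HILL.ibLen N) false).length = N := fun w => by
    rw [List.length_append, HILL.length_xOf, List.length_replicate, w.toList_length, HILL.nLen_add_ibLen]
  let z : List.Vector Bool N → List.Vector Bool N := fun w => ⟨HILL.xOf w.toList ++ List.replicate (HILL.ibLen N) false, hlen w⟩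
  have hz_mem : ∀ w, z w ∈ HILL.T f c N := fun w => by
    rw [HILL.mem_T]
    have hx : (HILL.xOf w.toList).length = HILL.nLen N := by rw [HILL.length_xOf, w.toList_length]
    have hib : (List.replicate (HILL.ibLen N) false).length = HILL.ibLen N := List.length_replicate ..
    show HILL.iOf (HILL.xOf w.toList ++ List.replicate (HILL.ibLen N) false) ≤
      HILL.Dtil f (HILL.xOf (HILL.xOf w.toList ++ List.replicate (HILL.ibLen N) false)) + c
    rw [HILL.iOf, HILL.iBits_append hx hib, bitsToNat_replicate_false]
    exact Nat.zero_le _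
  have hz_inj : Set.InjOn z layer := by
    intro w hw w' hw' h
    rw [Finset.mem_coe, hlayer, Finset.mem_filter] at hw hw'
    have h' : HILL.xOf w.toList = HILL.xOf w'.toList := List.append_cancel_right (congrArg List.Vector.toList h)
    -- same `x`, and the index blocks have the same value and the same length, hence are equal
    have hi : HILL.iOf w.toList = HILL.iOf w'.toList := by rw [hw.2, hw'.2, h']
    have hl1 : (HILL.iBits w.toList).length = HILL.ibLen N := by rw [HILL.length_iBits, w.toList_length]
    have hl2 : (HILL.iBits w'.toList).length = HILL.ibLen N := by rw [HILL.length_iBits, w'.toList_length]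
    have hib : HILL.iBits w.toList = HILL.iBits w'.toList := HILL.bits_eq_of_bitsToNat_eq (hl1.trans hl2.symm) hi
    apply List.Vector.toList_injective
    rw [← HILL.xOf_append_iBits w.toList, ← HILL.xOf_append_iBits w'.toList, h', hib]
  calc (HILL.T f (c + 1) N).card ≤ (HILL.T f c N ∪ layer).card := Finset.card_le_card hsplit
    _ ≤ (HILL.T f c N).card + layer.card := Finset.card_union_le _ _
    _ ≤ (HILL.T f c N).card + (HILL.T f c N).card := by
        refine Nat.add_le_add_left ?_ _
        calc layer.card = (layer.image z).card := (Finset.card_image_of_injOn hz_inj).symm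
          _ ≤ _ := Finset.card_le_card fun v hv => by
              obtain ⟨w, _, rfl⟩ := Finset.mem_image.1 hv
              exact hz_mem w
    _ = 2 * (HILL.T f c N).card := by ring

end Literature.Computability.Cryptography
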